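import Literature.MathematicalPhysics.QuantumManyBody.PeriodicHeatFlow
import Literature.MathematicalPhysics.QuantumManyBody.GroundStateFeynmanKacGaussian
import Literature.Probability.Process.GaussianBridgeLemmas
import Mathlib.MeasureTheory.Measure.Count
import HarnessLib

/-!
# The symmetrised Feynman–Kac (Ginibre loop-gas) representation of the periodic `N`-boson gas

Topic `Literature/MathematicalPhysics/QuantumManyBody` (definition item
`defn-PeriodicBosonLoopMeasure`; wanted by route `BECVortexSheetPeierls`, crux `HealingScaleTransfer`
— its layer-2 child `CellCurrentRepresentation` cannot be typed without it — and by the Feynman–Kac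
cards of `AtomisticToContinuum/BoseEinsteinCondensation` and the representation cruxes of route
`BECRenormGroup`). Built over the tree's canonical Brownian world-lines
(`GroundStateFeynmanKac.lean`: `PathSpace N`, `wienerPaths N`, `worldLine X ω s = X + √2 b_s`,
`expNeg`), the periodic vocabulary of `PeriodicBoseGas.lean` (`cell`, `cellN`, `latticeVec`,
`periodizedPotential`, `periodicInteraction`, `PeriodicTrialState`, `periodicGroundStateEnergy`,
`constantMode`, `condensateOccupation`) and the open-world-line torus semigroup of
`PeriodicHeatFlow.lean` (`periodicFKSemigroup`). Units `ħ = 2m = 1` throughout: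
`H_N^per = -∑ᵢ Δᵢ + ∑_{i<j} v^per(xᵢ - xⱼ)` on the torus `(ℝ³/Lℤ³)^N`, `v : ℝ → [0, ∞]` a repulsive
radial profile (hard cores `v = ⊤` allowed: infinite action, weight `e^{-∞} = 0`).

## Content

(a) **Bridges and the kernel.** `freeHeatKernel β X Y = p_β(X, Y) = (4πβ)^{-3N/2} e^{-|X-Y|²/4β}`
(product of Mathlib's `gaussianPDF` with variance `2β` per coordinate); the Brownian-bridge
world-lines `bridgeLine β X Y ω s = X + (s/β)(Y - X) + √2 (b_s - (s/β) b_β)` (Revuz–Yor's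
realisation of the bridge; under `wienerPaths N` the normalised bridge law); the periodised action
`bridgeAction = ∫₀^β ∑_{i<j} v^per(Bⁱ_s - Bʲ_s) ds`, the weight `bridgeWeight = e^{-bridgeAction}`, the
**bridge path measure** `bridgeMeasure v L β X Y = p_β(X,Y) · e^{-∫V^per} dW` on `PathSpace N`
(Glimm–Jaffe's conditional Wiener measure times the Feynman–Kac density, (3.1.9)–(3.1.12), (3.2.5)),
its mass `loopKernel v L β X Y = K_β(X, Y) = p_β(X,Y) E[e^{-∫₀^β V^per(B_s)ds}]` — the kernel of
`e^{-βH}` on the covering space — and the **torus kernel**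
`torusKernel v L β X Y = ∑_{n ∈ (ℤ³)^N} K_β(X, Y + Ln)` (Ueltschi, App. A: the Wiener measure of
the torus is the sum over windings of the bridges of the covering space, the periodic potential
being read along the lifts).

(b) **The symmetrised loop measure and the permutation sum.** `LoopSample N = S_N × (ℤ³)^N ×
(ℝ³)^N × PathSpace N` (permutation, windings, start, Brownian sample), `loopLine L β p s` its `N`
world-lines (bridges from `Xᵢ` to `X_{σ i} + L nᵢ`), and
`loopMeasure v N L β = (1/N!) ∑_σ ∑_n [𝟙_{cell^N}(X) dX ⊗ dW · p_β(X, X∘σ + Ln) e^{-∫₀^β V^per}]`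
pushed to `LoopSample N` — a sum of POSITIVE measures, one per `(σ, n)` (`sectorMeasure`). Its total
mass is the bosonic canonical partition function (`loopMeasure_univ`)
`loopPartition v N L β = Z_β(N,L) = Tr_{L²_sym} e^{-βH_N^per} = (1/N!) ∑_{σ∈S_N} permTerm σ`,
`permTerm σ = ∫_{cell^N} K^per_β(X, X∘σ) dX` (Ueltschi App. A `Y(N)`; König–Vogel–Zass Lemma 1.2), every
term nonnegative (`permTerm_nonneg`) and strictly positive for bounded periodised potentials
(`permTerm_pos`, `loopPartition_pos`; Glimm–Jaffe Thm 3.3.3); `Z_β(0, L) = 1`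
(`loopPartition_zero_particles`).

(c) **The one-particle density matrix with one open world-line.**
`openLineKernel v N L β x y = w_β(x,y) = (1/N!) ∑_σ ∫_{cell^{N-1}} K^per_β((x,U), σ·(y,U)) dU` (the
line from `x` is open and ends at `y`, the others close into loops) and
`loopDensityMatrix v N L β x y = γ_β(x, y) = N · w_β(x,y) / Z_β` (König–Vogel–Zass, proof of
Lemma 1.2; Ueltschi's `σ_ρ(x - y)`; trace `N`); the form `loopDensityMatrixForm f g = ⟨f, γ_β g⟩` with the
identity `⟨f, γ_β g⟩ = N · (∫∫ conj f · w_β · g) / Z_β` (`loopDensityMatrixForm_eq`), and the condensate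
occupation of the Gibbs state `loopCondensateOccupation = ⟨φ₀, γ_β φ₀⟩ = L⁻³ ∫∫_{cell²} γ_β`
(`φ₀ = constantMode L`).

(d) **The `β → ∞` link to the variational vocabulary.** `loopFreeEnergy = -β⁻¹ log Z_β`; the
hypothesis structure `IsLoopGroundState v L Ψ₀` ("`Ψ₀` is the periodic, Bose-symmetric, normalised
ground state and `E₀ = periodicGroundStateEnergy v N L` is the decay rate of the torus kernel with
residue `Ψ₀ ⊗ Ψ₀`": `e^{βE₀} K^per_β(X,Y) → Ψ₀(X)Ψ₀(Y)` with a uniform bound — the kernel form of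
the ground-state projection, Glimm–Jaffe (3.4.2), for the nondegenerate strictly positive ground
state, Thms 3.3.2–3.3.3), and, PROVED from it: `e^{βE₀} permTerm σ → ∫_cell Ψ₀² = 1` for every `σ`,
`e^{βE₀} Z_β → 1`, `Z_β ∈ (0, ∞)` eventually, **`F_β(N, L) → E₀ = periodicGroundStateEnergy v N L`**
(`IsLoopGroundState.tendsto_loopFreeEnergy`), `e^{βE₀} w_β(x,y) → ∫_{cell^{N-1}} Ψ₀(x,U)Ψ₀(y,U) dU`,
**`γ_β(x, y) → N ∫_{cell^{N-1}} Ψ₀(x,U) Ψ₀(y,U) dU`** (`tendsto_loopDensityMatrix`, the ground-state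
one-particle density matrix) and **`⟨φ₀, γ_β φ₀⟩ → condensateOccupation N L Ψ₀`**
(`tendsto_loopCondensateOccupation_condensateOccupation`, through the expansion
`condensateOccupation_ofReal_eq` of the tree's constant-mode occupation of a real state): at fixed
`(N, L)` the zero-temperature limit of the loop gas is governed by the infimum of `periodicEnergy`
over `PeriodicTrialState N L` and lands in the condensate vocabulary of the route items.

Proved API besides: **the kernel identity** `∫ K_β(X, Y) g(Y) dY = periodicFKSemigroup v L β g X`
(`lintegral_loopKernel_mul`; so `∫ K_β(X, ·) ≤ 1`), start/end/continuity of bridges and loop lines,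
joint measurability of bridges, actions, weights, kernels and loop lines (`measurable_of_sector`:
measurability on the sample space reduces to the continuous coordinates), `∫ f dμ_loop` sector by
sector (`lintegral_loopMeasure`, `lintegral_sectorMeasure`), `K_β ≤ p_β`, `K_β = p_β` for `v = 0`
(`loopKernel_zero_potential`, `torusKernel_zero_potential`: the free Bose gas / Bose loop soup of
König–Vogel–Zass), `∫ p_β(X, ·) = 1`, `E[F(X + √2 b_β)] = ∫ p_β(X,Y) F(Y) dY`.

## Design choices / what is NOT here

* Everything is a real definition over `[0, ∞]`-valued integrals; no operators. As in
  `GroundStateFeynmanKac.lean` / `PeriodicHeatFlow.lean`, `e^{-βH}` enters only through path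
  integrals: the Feynman–Kac formula (Ueltschi App. A, Glimm–Jaffe Thm 3.2.3, Ginibre) is the
  DEFINITION of the kernel, the partition function and the density matrix. That the bridge
  integral IS the kernel of the open-world-line semigroup of `PeriodicHeatFlow.lean` is PROVED:
  `∫ K_β(X, Y) g(Y) dY = periodicFKSemigroup v L β g X` (`lintegral_loopKernel_mul`, the
  disintegration of Wiener measure into Brownian bridges against the heat kernel: bridge parts
  independent of the endpoints, `indepFun_pathsBridge_pathsEnd`, read through the jointly
  measurable raw-path functionals of `GroundStateFeynmanKacSemigroup.lean`).
* Time `β` and path time `s` are real parameters (read through `Real.toNNReal`); for `β ≤ 0` the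
  objects take harmless junk values (`p_β = 0` for `N ≥ 1`), all statements of substance carry
  `0 < β`. World-lines live on the covering space `(ℝ³)^N`; the torus enters through the periodised
  potential, the cell of starting points and the winding sum — so cell charges, face crossings and
  windings of the projected loops are plain functions of `loopLine`.
* Hard cores: allowed everywhere (`v = ⊤` on a set of radii gives weight `0` to samples spending
  positive time in a core, Ueltschi's convention "we can allow the value `+∞`"); the strict
  positivity statements and `IsLoopGroundState`'s intended existence theorem are for bounded
  periodised potentials.
* NOT here: the existence of an `IsLoopGroundState` witness for bounded `v` (the torus
  Perron–Frobenius / spectral layer announced by `PeriodicHeatFlow.lean` for its sequel; no named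
  fact is introduced in this file), the periodisation of the kernel identity to the cell
  (`∫_cell K^per_β(X,Y) g(Y) dY = periodicFKSemigroup v L β g X` for periodic `g`), the
  Markov/concatenation property of bridges and the cycle (Bose-loop-soup) resummation
  `Z_N = ∑_λ ∏_k q_k^{λ_k}/(k^{λ_k} λ_k!)` of König–Vogel–Zass Lemma 1.2, the grand-canonical
  ensemble, the thermodynamic limit.
* Mathlib has Brownian motion only through the tree (`Literature.Probability.Process.brownian`) and no
  Brownian bridge, conditional Wiener measure or Bose gas (searched `bridge`, `Wiener`, `Bose`);
  `gaussianPDF`, `Measure.sum`, `Measure.prod`, `withDensity`, `Equiv.Perm` are Mathlib's. The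
  discrete σ-algebra on `Equiv.Perm (Fin N)` is declared here (`instMeasurableSpacePerm`).

## References

* D. Ueltschi, *Feynman cycles in the Bose gas*, J. Math. Phys. 47 (2006) 123303
  (arXiv:math-ph/0605002), Appendix A "Feynman–Kac representation of the Bose gas": the Wiener
  measure `W^β_{xy}` on the torus `T_L^d` as a sum over `z ∈ ℤ^d` with `g_t` of variance `2t` and
  `∫dW^β_{xy} = (4πβ)^{-d/2}∑_z e^{-(x-y+Lz)²/4β}`; the bridge shift `ω'(t) = ω(t) - t(y-x)/β`; the
  kernel of `e^{-βH}S` as `(1/N!)∑_π ∫dW^β_{x₁y_{π(1)}}⋯dW^β_{x_Ny_{π(N)}} e^{-∑_{i<j}∫₀^β U(ωᵢ-ωⱼ)ds}`;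
  `Y(N) = ∑_π (1/N!) ∫_{D^N} dx ∫dW^β_{x_i x_{π(i)}} e^{-∑∫U}`; `Tr(N_φ e^{-βH})`, `ϱ⁽⁰⁾_ρ` and
  `σ_ρ(x-y)` (one open trajectory from `x` to `y`); §2.1 (`Y(0) = 1`). [Ueltschi2006]
* W. König, Q. Vogel, A. Zass, *Off-diagonal long-range order for the free Bose gas via the
  Feynman–Kac formula*, Ann. Appl. Probab. 35 (2025) (arXiv:2312.07481): §1.1 `Z_N = Tr(Π₊ e^{-βH})`,
  §1.2 `Γ_N = (N/Z_N) Tr_{N-1}(Π₊ e^{-βH})`, Lemma 1.2 (FK-representations) and its proof in §5: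
  `Z_N = (1/N!)∑_σ ∫ [⊗ᵢ μ^β_{xᵢ,x_{σ(i)}}](1) dx`, `γ_N(x,y) = N/(Z_N N!) ∑_σ ∫ M_{(x,u),σ(y,u)}[1] du`.
  [KonigVogelZass2025]
* J. Glimm, A. Jaffe, *Quantum Physics* (2nd ed., 1987): §3.1 (3.1.9)–(3.1.12), Thm 3.1.1
  (conditional Wiener measure), §3.2 Thm 3.2.3 (3.2.5) (Feynman–Kac formula for the kernel), §3.3
  Thms 3.3.2–3.3.3 (3.3.4) (positivity, uniqueness of the ground state), §3.4 (3.4.2). [GlimmJaffeQP1987]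
* J. Ginibre, *Some applications of functional integration in statistical mechanics*, Les Houches
  1970 (Gordon and Breach 1971) — the original loop-gas representation. [Ginibre1971]
* D. Revuz, M. Yor, *Continuous Martingales and Brownian Motion* (1999), Ch. I §3: the Brownian
  bridge `X^y_t = B_t - t(B_1 - y)`, Exercise (3.16) (bridge = conditioned Brownian motion). [RevuzYor1999]
* K. L. Chung, Z. Zhao, *From Brownian Motion to Schrödinger's Equation* (1995), (1.11), §3.3 (3.33)
  (the free heat kernel, as in `GroundStateFeynmanKacGaussian.lean`). [ChungZhao1995]
-/


noncomputable section

open MeasureTheory ProbabilityTheory Filter Metric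
open scoped ENNReal NNReal Topology ComplexConjugate

namespace Literature.MathematicalPhysics.QuantumManyBody.BoseGas

open Literature.Probability.Process (preWienerMeasure brownian brownian_zero measurable_brownian
  continuous_brownian)

variable {N : ℕ}

/-! ### The free heat kernel and the Brownian-bridge world-lines -/

/-- The **free heat kernel** `p_β(X, Y) = (4πβ)^{-3N/2} exp(-|X - Y|²/4β)` of `e^{βΔ}` on
`(ℝ³)^N` (`ħ = 2m = 1`: the Gaussian of variance `2β` in each of the `3N` coordinates), written as
the product of Mathlib's one-dimensional Gaussian densities; `0` for `β ≤ 0`. This is the total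
mass of the conditional Wiener (Brownian-bridge) measure from `X` to `Y` in time `β`.
[cite: Ueltschi2006, Appendix A (∫dW^β_{xy} = (4πβ)^{-d/2} ∑_z e^{-(x-y+Lz)²/4β})] -/
def freeHeatKernel (β : ℝ) (X Y : Config N) : ℝ≥0∞ :=
  ∏ i, ∏ k, gaussianPDF (X i k) (2 * β.toNNReal) (Y i k)

/-- The **Brownian-bridge world-lines** of duration `β` from `X` to `Y` driven by the sample `ω`:
`Bⁱ_s = Xᵢ + (s/β)(Yᵢ - Xᵢ) + √2 (bⁱ_s - (s/β) bⁱ_β)`, i.e. the free world-line `Xᵢ + √2 bⁱ_s`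
corrected linearly so as to end at `Yᵢ` at time `β` (Lévy/Revuz–Yor realisation of the bridge as
`B_s - (s/β)B_β`; under `wienerPaths N` its law is the normalised bridge law). Read at real times
through `Real.toNNReal`; only `s ∈ [0, β]` matters. [cite: RevuzYor1999, Ch. I §3 (Brownian Bridge)] -/
def bridgeLine (β : ℝ) (X Y : Config N) (ω : PathSpace N) (s : ℝ) : Config N :=
  worldLine X ω s.toNNReal + (s / β) • (Y - worldLine X ω β.toNNReal)

/-- The **periodised pair action along the bridge**,
`∫₀^β ∑_{i<j} v^per(Bⁱ_s - Bʲ_s) ds ∈ [0, ∞]` (`v^per = periodizedPotential v L`, the interaction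
of the torus `ℝ³/Lℤ³` read on the covering space). [cite: Ueltschi2006, Appendix A (kernel K of e^{-βH}S)] -/
def bridgeAction (v : ℝ → ℝ≥0∞) (L β : ℝ) (X Y : Config N) (ω : PathSpace N) : ℝ≥0∞ :=
  ∫⁻ s in Set.Ioc (0 : ℝ) β, periodicInteraction v L (bridgeLine β X Y ω s)

/-- The **Feynman–Kac weight of a bridge sample**, `exp(-∫₀^β ∑_{i<j} v^per(Bⁱ_s - Bʲ_s) ds) ∈ [0, 1]`
(`e^{-∞} = 0`: an infinite action — hard cores — kills the sample). [cite: Ueltschi2006, Appendix A (kernel K of e^{-βH}S)] -/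
def bridgeWeight (v : ℝ → ℝ≥0∞) (L β : ℝ) (X Y : Config N) (ω : PathSpace N) : ℝ≥0∞ :=
  expNeg (bridgeAction v L β X Y ω)

/-- The **interaction-weighted Brownian-bridge path measure** from `X` to `Y` in time `β` on the
covering space `(ℝ³)^N`: `p_β(X,Y) · exp(-∫₀^β ∑_{i<j} v^per) d(bridge law)`, realised on the
canonical sample space `PathSpace N` (the bridge is the random path `bridgeLine β X Y ·`). Its total
mass is the kernel `loopKernel v L β X Y` of `e^{-βH}` (Feynman–Kac formula for the kernel,
Glimm–Jaffe (3.2.5)). [cite: GlimmJaffeQP1987, §3.2 Thm 3.2.3 (3.2.5)] -/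
def bridgeMeasure (v : ℝ → ℝ≥0∞) (L β : ℝ) (X Y : Config N) : Measure (PathSpace N) :=
  freeHeatKernel β X Y • (wienerPaths N).withDensity (bridgeWeight v L β X Y)

/-- The **Feynman–Kac kernel** `K_β(X, Y) = p_β(X,Y) · E[exp(-∫₀^β ∑_{i<j} v^per(Bⁱ_s - Bʲ_s) ds)]`
of `e^{-βH}`, `H = -∑ᵢΔᵢ + ∑_{i<j} v^per(xᵢ - xⱼ)` on the covering space `(ℝ³)^N`
(DISTINGUISHABLE particles, one winding sector), as a conditional-Wiener (bridge) integral.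
[cite: Ueltschi2006, Appendix A (kernel K of e^{-βH}S)] -/
def loopKernel (v : ℝ → ℝ≥0∞) (L β : ℝ) (X Y : Config N) : ℝ≥0∞ :=
  freeHeatKernel β X Y * ∫⁻ ω, bridgeWeight v L β X Y ω ∂wienerPaths N

/-! ### Periodisation: winding sectors and the torus kernel -/

/-- Winding numbers of `N` world-lines around the torus `ℝ³/Lℤ³`: one lattice vector per particle.
[cite: Ueltschi2006, Appendix A (Wiener measure W^β_{xy} on the torus as a sum over z ∈ ℤ^d)] -/
abbrev Winding (N : ℕ) : Type := Fin N → Fin 3 → ℤ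

/-- The configuration shift `(L nᵢ)ᵢ ∈ (Lℤ³)^N ⊂ (ℝ³)^N` of a winding vector. [cite: Ueltschi2006, Appendix A (Wiener measure W^β_{xy} on the torus as a sum over z ∈ ℤ^d)] -/
def latticeShift (L : ℝ) (n : Winding N) : Config N := fun i => latticeVec L (n i)

/-- The **torus Feynman–Kac kernel** of `e^{-βH_N^per}` between points of the fundamental cell,
`K^per_β(X, Y) = ∑_{n ∈ (ℤ³)^N} K_β(X, Y + Ln)`: the Brownian bridge of the flat torus from `Xᵢ` to
`Yᵢ` is the sum over windings `nᵢ ∈ ℤ³` of the bridges of the covering space from `Xᵢ` to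
`Yᵢ + L nᵢ`, and the periodic potential is read along the lifted paths.
[cite: Ueltschi2006, Appendix A (Wiener measure W^β_{xy} on the torus as a sum over z ∈ ℤ^d)] -/
def torusKernel (v : ℝ → ℝ≥0∞) (L β : ℝ) (X Y : Config N) : ℝ≥0∞ :=
  ∑' n : Winding N, loopKernel v L β X (Y + latticeShift L n)

/-! ### The symmetrised loop measure -/

/-- The discrete σ-algebra on the finite group of particle labels' permutations. [folklore] -/
instance instMeasurableSpacePerm : MeasurableSpace (Equiv.Perm (Fin N)) := ⊤

/-- Singletons of permutations are measurable (discrete σ-algebra). [folklore] -/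
instance instMeasurableSingletonClassPerm : MeasurableSingletonClass (Equiv.Perm (Fin N)) :=
  ⟨fun _ => trivial⟩

/-- **Samples of the loop gas**: a permutation `σ` (particle `i` ends where particle `σ i` started),
a winding vector `n`, the starting configuration `X ∈ [0,L)^{3N}` and the Brownian sample `ω`
driving the `N` bridges. [cite: Ueltschi2006, Appendix A (Y(N) as a sum over π ∈ S_N)] -/
abbrev LoopSample (N : ℕ) : Type := Equiv.Perm (Fin N) × Winding N × Config N × PathSpace N

namespace LoopSample

/-- The permutation of a sample. [folklore] -/
abbrev perm (p : LoopSample N) : Equiv.Perm (Fin N) := p.1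
/-- The winding vector of a sample. [folklore] -/
abbrev winding (p : LoopSample N) : Winding N := p.2.1
/-- The starting configuration of a sample. [folklore] -/
abbrev start (p : LoopSample N) : Config N := p.2.2.1
/-- The Brownian sample driving the bridges. [folklore] -/
abbrev path (p : LoopSample N) : PathSpace N := p.2.2.2
/-- The terminal configuration `(X_{σ i} + L nᵢ)ᵢ` of a sample (on the covering space).
[cite: Ueltschi2006, Appendix A (Y(N) as a sum over π ∈ S_N)] -/
def finish (L : ℝ) (p : LoopSample N) : Config N := p.start ∘ p.perm + latticeShift L p.winding

end LoopSample

/-- **The world-lines of a loop-gas sample**: the `N` Brownian bridges of duration `β` from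
`Xᵢ` to `X_{σ i} + L nᵢ` on the covering space `(ℝ³)^N` (project modulo `Lℤ³` for the torus
picture; composing along the cycles of `σ` gives Feynman's closed loops).
[cite: Ueltschi2006, Appendix A (Y(N) as a sum over π ∈ S_N)] -/
def loopLine (L β : ℝ) (p : LoopSample N) (s : ℝ) : Config N :=
  bridgeLine β p.start (p.finish L) p.path s

/-- The density of the loop measure in the sector `(σ, n)` with respect to
`dX|_{[0,L)^{3N}} ⊗ dW`: `p_β(X, X∘σ + Ln) · exp(-∫₀^β ∑_{i<j} v^per(Bⁱ_s - Bʲ_s) ds)`.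
[cite: Ueltschi2006, Appendix A (Y(N) as a sum over π ∈ S_N)] -/
def loopDensity (v : ℝ → ℝ≥0∞) (L β : ℝ) (σ : Equiv.Perm (Fin N)) (n : Winding N)
    (p : Config N × PathSpace N) : ℝ≥0∞ :=
  freeHeatKernel β p.1 (p.1 ∘ σ + latticeShift L n) *
    bridgeWeight v L β p.1 (p.1 ∘ σ + latticeShift L n) p.2

/-- The **sector measure** of `(σ, n)`: `𝟙_{[0,L)^{3N}}(X) dX ⊗ dW(ω)` weighted by the loop
density `p_β(X, X∘σ + Ln) e^{-∫₀^β ∑_{i<j} v^per}` — the joint law of (start, Brownian sample) of the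
`N` bridges from `X` to `X∘σ + Ln`, a finite positive measure. [cite: Ueltschi2006, Appendix A (Y(N) as a sum over π ∈ S_N)] -/
def sectorMeasure (v : ℝ → ℝ≥0∞) (L β : ℝ) (σ : Equiv.Perm (Fin N)) (n : Winding N) :
    Measure (Config N × PathSpace N) :=
  ((volume.restrict (cellN N L)).prod (wienerPaths N)).withDensity (loopDensity v L β σ n)

/-- **The symmetrised Feynman–Kac (Ginibre loop-gas) measure of the periodic `N`-boson gas** at
inverse temperature `β` on the torus `ℝ³/Lℤ³` (`H_N^per = -∑ᵢΔᵢ + ∑_{i<j} v^per(xᵢ - xⱼ)`,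
`ħ = 2m = 1`): the finite measure on `LoopSample N` given by
`(1/N!) ∑_{σ ∈ S_N} ∑_{n ∈ (ℤ³)^N} 𝟙_{[0,L)^{3N}}(X) dX ⊗ dW(ω) · p_β(X, X∘σ + Ln) e^{-∫₀^β ∑_{i<j} v^per(Bⁱ_s - Bʲ_s) ds}`,
the world-lines being the bridges `loopLine`. Its total mass is the canonical partition function
`loopPartition v N L β = Tr_{L²_sym} e^{-βH_N^per}` (`loopMeasure_univ`), and every term of the
permutation sum is a POSITIVE measure (no signs for bosons). [cite: Ueltschi2006, Appendix A (Y(N) as a sum over π ∈ S_N)] -/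
def loopMeasure (v : ℝ → ℝ≥0∞) (N : ℕ) (L β : ℝ) : Measure (LoopSample N) :=
  Measure.sum fun σ : Equiv.Perm (Fin N) => Measure.sum fun n : Winding N =>
    (((Nat.factorial N : ℝ≥0∞)⁻¹ • sectorMeasure v L β σ n).map fun p => (σ, n, p))

/-- The contribution of the permutation `σ` to the partition function:
`∫_{[0,L)^{3N}} K^per_β(X, X∘σ) dX = ∫ dX ∫ dW^β_{x₁ x_{σ 1}} ⋯ dW^β_{x_N x_{σ N}} e^{-∑_{i<j}∫₀^β v^per}`.
[cite: Ueltschi2006, Appendix A (Y(N) as a sum over π ∈ S_N)] -/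
def permTerm (v : ℝ → ℝ≥0∞) (N : ℕ) (L β : ℝ) (σ : Equiv.Perm (Fin N)) : ℝ≥0∞ :=
  ∫⁻ X in cellN N L, torusKernel v L β X (X ∘ σ)

/-- **The canonical partition function of `N` bosons on the torus**,
`Z_β(N, L) = Tr_{L²_sym((ℝ³/Lℤ³)^N)} e^{-βH_N^per} = (1/N!) ∑_{σ ∈ S_N} ∫_{[0,L)^{3N}} K^per_β(X, X∘σ) dX`
in its Feynman–Kac form (Ueltschi's `Y(N)`; König–Vogel–Zass's `Z_N`).
[cite: Ueltschi2006, Appendix A (Y(N) as a sum over π ∈ S_N)] -/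
def loopPartition (v : ℝ → ℝ≥0∞) (N : ℕ) (L β : ℝ) : ℝ≥0∞ :=
  ((Nat.factorial N : ℝ≥0∞))⁻¹ * ∑ σ : Equiv.Perm (Fin N), permTerm v N L β σ

/-! ### The one-particle density matrix: one open world-line -/

/-- **The open-line weight** `w_β(x, y) = (1/N!) ∑_{σ ∈ S_N} ∫_{[0,L)^{3(N-1)}} K^per_β((x, U), σ·(y, U)) dU`:
the loop gas in which the world-line starting at `x` is OPEN and ends at `y` (after its cycle
through the other particles), all other lines closing up as loops; `0` for `N = 0`.
[cite: KonigVogelZass2025, §5, proof of Lemma 1.2 (formula for γ_N(x,y))] -/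
def openLineKernel (v : ℝ → ℝ≥0∞) : (N : ℕ) → (L β : ℝ) → Space → Space → ℝ≥0∞
  | 0, _, _, _, _ => 0
  | n + 1, L, β, x, y => ((Nat.factorial (n + 1) : ℝ≥0∞))⁻¹ *
      ∑ σ : Equiv.Perm (Fin (n + 1)),
        ∫⁻ U in cellN n L, torusKernel v L β (Matrix.vecCons x U) (Matrix.vecCons y U ∘ σ)

/-- **The one-particle density matrix of the canonical Gibbs state of `N` bosons on the torus**,
`γ_β(x, y) = N · w_β(x, y) / Z_β(N, L)` — the kernel of `N · Tr_{N-1}(Π₊ e^{-βH}) / Z` (trace `N`),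
as the loop gas with one open world-line from `x` to `y` ("worm"), Ueltschi's `σ_ρ(x - y)`,
König–Vogel–Zass's `γ_N(x, y)`. [cite: KonigVogelZass2025, §5, proof of Lemma 1.2 (formula for γ_N(x,y))] -/
def loopDensityMatrix (v : ℝ → ℝ≥0∞) (N : ℕ) (L β : ℝ) (x y : Space) : ℝ≥0∞ :=
  N * openLineKernel v N L β x y / loopPartition v N L β

/-- The quadratic form `⟨f, γ_β g⟩ = ∫_cell ∫_cell conj(f(x)) γ_β(x, y) g(y) dy dx` of the
one-particle density matrix on one-body modes of the cell (complex Bochner integral of the real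
kernel). [cite: KonigVogelZass2025, §1.2 (Γ_N and σ_N)] -/
def loopDensityMatrixForm (v : ℝ → ℝ≥0∞) (N : ℕ) (L β : ℝ) (f g : Space → ℂ) : ℂ :=
  ∫ x in cell L, ∫ y in cell L,
    conj (f x) * ((loopDensityMatrix v N L β x y).toReal : ℂ) * g y

/-- **The condensate occupation of the Gibbs state**, `⟨φ₀, γ_β φ₀⟩ = L⁻³ ∫_cell ∫_cell γ_β(x, y) dx dy`
for the constant mode `φ₀ = L^{-3/2} 𝟙_cell` (`constantMode L`): the expected number of particles
in the zero-momentum mode, `Tr(N_{φ₀} e^{-βH}) / Y(N)`. [cite: Ueltschi2006, Appendix A (ϱ⁽⁰⁾_ρ and Tr(N_φ e^{-βH}))] -/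
def loopCondensateOccupation (v : ℝ → ℝ≥0∞) (N : ℕ) (L β : ℝ) : ℝ≥0∞ :=
  (ENNReal.ofReal L ^ 3)⁻¹ * ∫⁻ x in cell L, ∫⁻ y in cell L, loopDensityMatrix v N L β x y

/-- The **free energy** `F_β(N, L) = -β⁻¹ log Z_β(N, L)` of `N` bosons on the torus (finite volume,
canonical). [cite: Ueltschi2006, Appendix A (thermodynamic potentials f(β,ρ), p(β,μ))] -/
def loopFreeEnergy (v : ℝ → ℝ≥0∞) (N : ℕ) (L β : ℝ) : ℝ :=
  -Real.log (loopPartition v N L β).toReal / β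


/-! ### Basic API: the bridge -/

/-- The bridge starts at `X`: `B_0 = X`. [folklore] -/
@[simp] theorem bridgeLine_zero (β : ℝ) (X Y : Config N) (ω : PathSpace N) :
    bridgeLine β X Y ω 0 = X := by
  simp [bridgeLine]

/-- The bridge ends at `Y`: `B_β = Y` (`β ≠ 0`). [folklore] -/
@[simp] theorem bridgeLine_self {β : ℝ} (hβ : β ≠ 0) (X Y : Config N) (ω : PathSpace N) :
    bridgeLine β X Y ω β = Y := by
  simp [bridgeLine, div_self hβ]

/-- For `β ≤ 0` only the (junk) time `s ≤ 0` values are ever read; at nonpositive times the free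
world-line sits at `X`. [folklore] -/
theorem bridgeLine_of_nonpos (β : ℝ) (X Y : Config N) (ω : PathSpace N) {s : ℝ} (hs : s ≤ 0) :
    bridgeLine β X Y ω s = X + (s / β) • (Y - worldLine X ω β.toNNReal) := by
  simp [bridgeLine, Real.toNNReal_of_nonpos hs]

/-- Every bridge world-line is continuous in time. [folklore] -/
theorem continuous_bridgeLine (β : ℝ) (X Y : Config N) (ω : PathSpace N) :
    Continuous (bridgeLine β X Y ω) := by
  unfold bridgeLine
  exact (continuous_worldLine_toNNReal X ω).add
    ((continuous_id.div_const β).smul continuous_const)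

/-- The bridge world-lines in coordinates: `Bⁱ_s = Xᵢ + (s/β)(Yᵢ - Xᵢ) + √2 (bⁱ_s - (s/β) bⁱ_β)`,
the Revuz–Yor form `x + (s/β)(y - x) + (B_s - (s/β)B_β)`. [cite: RevuzYor1999, Ch. I §3 (Brownian Bridge)] -/
theorem bridgeLine_apply (β : ℝ) (X Y : Config N) (ω : PathSpace N) (s : ℝ) (i : Fin N) (k : Fin 3) :
    bridgeLine β X Y ω s i k = X i k + s / β * (Y i k - X i k) +
      Real.sqrt 2 * (brownian s.toNNReal (ω i k) - s / β * brownian β.toNNReal (ω i k)) := by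
  simp only [bridgeLine, worldLine, Pi.add_apply, Pi.smul_apply, Pi.sub_apply, PiLp.add_apply,
    PiLp.smul_apply, PiLp.sub_apply, smul_eq_mul]
  ring

/-- For `β ≤ 0` the action is over the empty time interval. [folklore] -/
theorem bridgeAction_of_nonpos (v : ℝ → ℝ≥0∞) (L : ℝ) {β : ℝ} (hβ : β ≤ 0) (X Y : Config N)
    (ω : PathSpace N) : bridgeAction v L β X Y ω = 0 := by
  simp [bridgeAction, Set.Ioc_eq_empty_of_le hβ]

/-- The bridge weight is at most `1`. [folklore] -/
theorem bridgeWeight_le_one (v : ℝ → ℝ≥0∞) (L β : ℝ) (X Y : Config N) (ω : PathSpace N) :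
    bridgeWeight v L β X Y ω ≤ 1 :=
  expNeg_le_one _

/-- The bridge weight is finite. [folklore] -/
theorem bridgeWeight_ne_top (v : ℝ → ℝ≥0∞) (L β : ℝ) (X Y : Config N) (ω : PathSpace N) :
    bridgeWeight v L β X Y ω ≠ ⊤ :=
  ne_top_of_le_ne_top ENNReal.one_ne_top (bridgeWeight_le_one v L β X Y ω)

/-- For `β ≤ 0` the weight is `1`. [folklore] -/
theorem bridgeWeight_of_nonpos (v : ℝ → ℝ≥0∞) (L : ℝ) {β : ℝ} (hβ : β ≤ 0) (X Y : Config N)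
    (ω : PathSpace N) : bridgeWeight v L β X Y ω = 1 := by
  simp [bridgeWeight, bridgeAction_of_nonpos v L hβ]

/-- The free gas: with `v = 0` the weight is identically `1`. [folklore] -/
theorem bridgeWeight_zero_potential (L β : ℝ) (X Y : Config N) (ω : PathSpace N) :
    bridgeWeight 0 L β X Y ω = 1 := by
  simp [bridgeWeight, bridgeAction, periodicInteraction, periodizedPotential]

/-- The expected bridge weight is at most `1` (probability reference measure). [folklore] -/
theorem lintegral_bridgeWeight_le_one (v : ℝ → ℝ≥0∞) (L β : ℝ) (X Y : Config N) :
    ∫⁻ ω, bridgeWeight v L β X Y ω ∂wienerPaths N ≤ 1 := by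
  calc ∫⁻ ω, bridgeWeight v L β X Y ω ∂wienerPaths N ≤ ∫⁻ _ω, 1 ∂wienerPaths N :=
        lintegral_mono fun ω => bridgeWeight_le_one v L β X Y ω
    _ = 1 := by rw [lintegral_const, measure_univ, mul_one]

/-! ### Basic API: the free heat kernel -/

/-- The free heat kernel is symmetric. [folklore] -/
theorem freeHeatKernel_symm (β : ℝ) (X Y : Config N) :
    freeHeatKernel β X Y = freeHeatKernel β Y X :=
  heatKernel_symm X Y β.toNNReal

/-- The free heat kernel is finite. [folklore] -/
theorem freeHeatKernel_lt_top (β : ℝ) (X Y : Config N) : freeHeatKernel β X Y < ⊤ := by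
  unfold freeHeatKernel
  refine ENNReal.prod_lt_top fun i _ => ENNReal.prod_lt_top fun k _ => ?_
  simp [gaussianPDF]

/-- The free heat kernel is finite. [folklore] -/
theorem freeHeatKernel_ne_top (β : ℝ) (X Y : Config N) : freeHeatKernel β X Y ≠ ⊤ :=
  (freeHeatKernel_lt_top β X Y).ne

/-- The free heat kernel is strictly positive at positive times. [folklore] -/
theorem freeHeatKernel_pos {β : ℝ} (hβ : 0 < β) (X Y : Config N) : 0 < freeHeatKernel β X Y := by
  unfold freeHeatKernel
  have hv : (2 * β.toNNReal : ℝ≥0) ≠ 0 :=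
    mul_ne_zero two_ne_zero (Real.toNNReal_pos.2 hβ).ne'
  refine pos_iff_ne_zero.2 (Finset.prod_ne_zero_iff.2 fun i _ => Finset.prod_ne_zero_iff.2 fun k _ => ?_)
  exact (gaussianPDF_pos _ hv _).ne'

/-- At nonpositive times the free heat kernel of `N ≥ 1` particles vanishes (zero variance; a junk
value, as all uses carry `0 < β`). [folklore] -/
theorem freeHeatKernel_of_nonpos {β : ℝ} (hβ : β ≤ 0) (hN : N ≠ 0) (X Y : Config N) :
    freeHeatKernel β X Y = 0 := by
  obtain ⟨i⟩ : Nonempty (Fin N) := Fin.pos_iff_nonempty.1 (Nat.pos_of_ne_zero hN)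
  unfold freeHeatKernel
  refine Finset.prod_eq_zero (Finset.mem_univ i) (Finset.prod_eq_zero (Finset.mem_univ 0) ?_)
  simp [Real.toNNReal_of_nonpos hβ, gaussianPDF]

/-- The free heat kernel has total mass one in the second variable (`β > 0`). [folklore] -/
theorem lintegral_freeHeatKernel {β : ℝ} (hβ : 0 < β) (X : Config N) :
    ∫⁻ Y, freeHeatKernel β X Y = 1 :=
  lintegral_heatKernel X (t := β.toNNReal) (by simpa using hβ)

/-- **The free expectation through the heat kernel**: `E[F(X + √2 b_β)] = ∫ p_β(X, Y) F(Y) dY` for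
measurable `F ≥ 0` and `β > 0`. [cite: ChungZhao1995, (1.11) and §3.3 (3.33)] -/
theorem lintegral_worldLine_eq_freeHeatKernel {β : ℝ} (hβ : 0 < β) (X : Config N)
    {F : Config N → ℝ≥0∞} (hF : Measurable F) :
    ∫⁻ ω, F (worldLine X ω β.toNNReal) ∂wienerPaths N = ∫⁻ Y, freeHeatKernel β X Y * F Y :=
  lintegral_worldLine_eq X (t := β.toNNReal) (by simpa using hβ) hF

/-! ### Basic API: the kernels -/

/-- The total mass of the bridge measure is the Feynman–Kac kernel. [cite: GlimmJaffeQP1987, §3.2 (3.2.5)] -/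
theorem bridgeMeasure_univ (v : ℝ → ℝ≥0∞) (L β : ℝ) (X Y : Config N) :
    bridgeMeasure v L β X Y Set.univ = loopKernel v L β X Y := by
  rw [bridgeMeasure, Measure.smul_apply, withDensity_apply _ MeasurableSet.univ,
    Measure.restrict_univ, smul_eq_mul, loopKernel]

/-- The kernel is dominated by the free kernel: `K_β(X, Y) ≤ p_β(X, Y)` (weights `≤ 1`).
[cite: GlimmJaffeQP1987, §3.2 (3.2.5)] -/
theorem loopKernel_le_freeHeatKernel (v : ℝ → ℝ≥0∞) (L β : ℝ) (X Y : Config N) :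
    loopKernel v L β X Y ≤ freeHeatKernel β X Y := by
  calc loopKernel v L β X Y ≤ freeHeatKernel β X Y * 1 :=
        mul_le_mul' le_rfl (lintegral_bridgeWeight_le_one v L β X Y)
    _ = freeHeatKernel β X Y := mul_one _

/-- The kernel is finite. [folklore] -/
theorem loopKernel_ne_top (v : ℝ → ℝ≥0∞) (L β : ℝ) (X Y : Config N) : loopKernel v L β X Y ≠ ⊤ :=
  ne_top_of_le_ne_top (freeHeatKernel_ne_top β X Y) (loopKernel_le_freeHeatKernel v L β X Y)

/-- The bridge measure is finite. [folklore] -/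
instance isFiniteMeasure_bridgeMeasure (v : ℝ → ℝ≥0∞) (L β : ℝ) (X Y : Config N) :
    IsFiniteMeasure (bridgeMeasure v L β X Y) :=
  ⟨by rw [bridgeMeasure_univ]; exact (loopKernel_ne_top v L β X Y).lt_top⟩

/-- **The free gas**: for `v = 0` the kernel is the free heat kernel, `K_β = p_β`.
[cite: Ueltschi2006, Appendix A (∫dW^β_{xy} = (4πβ)^{-d/2} ∑_z e^{-(x-y+Lz)²/4β})] -/
theorem loopKernel_zero_potential (L β : ℝ) (X Y : Config N) :
    loopKernel 0 L β X Y = freeHeatKernel β X Y := by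
  simp [loopKernel, bridgeWeight_zero_potential]

/-- Each winding sector contributes to the torus kernel: `K_β(X, Y + Ln) ≤ K^per_β(X, Y)`.
[cite: Ueltschi2006, Appendix A (Wiener measure W^β_{xy} on the torus as a sum over z ∈ ℤ^d)] -/
theorem loopKernel_le_torusKernel (v : ℝ → ℝ≥0∞) (L β : ℝ) (X Y : Config N) (n : Winding N) :
    loopKernel v L β X (Y + latticeShift L n) ≤ torusKernel v L β X Y :=
  ENNReal.le_tsum (f := fun n : Winding N => loopKernel v L β X (Y + latticeShift L n)) n

/-- The zero winding vector is the zero shift. [folklore] -/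
@[simp] theorem latticeShift_zero (L : ℝ) : latticeShift L (0 : Winding N) = 0 := by
  funext i; simp [latticeShift]

/-- **The free gas on the torus**: for `v = 0` the torus kernel is the periodised heat kernel
`∑_{n} p_β(X, Y + Ln)`, Ueltschi's `∫ dW^β_{xy} = (4πβ)^{-d/2} ∑_z e^{-(x-y+Lz)²/4β}` per particle.
[cite: Ueltschi2006, Appendix A (∫dW^β_{xy} = (4πβ)^{-d/2} ∑_z e^{-(x-y+Lz)²/4β})] -/
theorem torusKernel_zero_potential (L β : ℝ) (X Y : Config N) :
    torusKernel 0 L β X Y = ∑' n : Winding N, freeHeatKernel β X (Y + latticeShift L n) := by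
  simp [torusKernel, loopKernel_zero_potential]


/-! ### Measurability -/

/-- Relabelling the particles is measurable on configurations. [folklore] -/
theorem measurable_comp_perm (σ : Equiv.Perm (Fin N)) : Measurable fun X : Config N => X ∘ σ :=
  measurable_pi_lambda _ fun i => measurable_pi_apply (σ i)

/-- The bridge world-lines are jointly measurable in (start, end, sample, real time). [folklore] -/
theorem measurable_bridgeLine_prod (β : ℝ) :
    Measurable fun q : ((Config N × Config N) × PathSpace N) × ℝ =>
      bridgeLine β q.1.1.1 q.1.1.2 q.1.2 q.2 := by
  have hφ : Measurable fun q : ((Config N × Config N) × PathSpace N) × ℝ =>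
      ((q.1.1.1, q.1.2), q.2) := by fun_prop
  have hψ : Measurable fun q : ((Config N × Config N) × PathSpace N) × ℝ =>
      ((q.1.1.1, q.1.2), β) := by fun_prop
  have h1 := measurable_worldLine_prod.comp hφ
  have h2 := measurable_worldLine_prod.comp hψ
  have hY : Measurable fun q : ((Config N × Config N) × PathSpace N) × ℝ => q.1.1.2 := by fun_prop
  have hs : Measurable fun q : ((Config N × Config N) × PathSpace N) × ℝ => q.2 / β :=
    measurable_snd.div_const β
  exact h1.add (hs.smul (hY.sub h2))

/-- The bridge world-line at a fixed time is jointly measurable in (start, end, sample). [folklore] -/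
theorem measurable_bridgeLine_at (β s : ℝ) :
    Measurable fun q : (Config N × Config N) × PathSpace N => bridgeLine β q.1.1 q.1.2 q.2 s := by
  have hg : Measurable fun q : (Config N × Config N) × PathSpace N => (q, s) :=
    measurable_id.prodMk measurable_const
  simpa only [Function.comp_def] using (measurable_bridgeLine_prod β).comp hg

/-- For fixed endpoints, each time-marginal of the bridge is measurable in the sample. [folklore] -/
theorem measurable_bridgeLine (β : ℝ) (X Y : Config N) (s : ℝ) :
    Measurable fun ω : PathSpace N => bridgeLine β X Y ω s := by
  have hg : Measurable fun ω : PathSpace N => (((X, Y), ω) : (Config N × Config N) × PathSpace N) :=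
    measurable_const.prodMk measurable_id
  simpa only [Function.comp_def] using (measurable_bridgeLine_at β s).comp hg

/-- **Joint measurability of the bridge action** in (start, end, sample) (Tonelli), for measurable
`v`. [folklore] -/
theorem measurable_bridgeAction_uncurry {v : ℝ → ℝ≥0∞} (hv : Measurable v) (L β : ℝ) :
    Measurable fun q : (Config N × Config N) × PathSpace N => bridgeAction v L β q.1.1 q.1.2 q.2 :=
  ((measurable_periodicInteraction hv L).comp (measurable_bridgeLine_prod β)).lintegral_prod_right'

/-- Joint measurability of the bridge weight. [folklore] -/
theorem measurable_bridgeWeight_uncurry {v : ℝ → ℝ≥0∞} (hv : Measurable v) (L β : ℝ) :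
    Measurable fun q : (Config N × Config N) × PathSpace N => bridgeWeight v L β q.1.1 q.1.2 q.2 :=
  measurable_expNeg.comp (measurable_bridgeAction_uncurry hv L β)

/-- The bridge weight is measurable in the sample. [folklore] -/
theorem measurable_bridgeWeight {v : ℝ → ℝ≥0∞} (hv : Measurable v) (L β : ℝ) (X Y : Config N) :
    Measurable (bridgeWeight v L β X Y) := by
  have hg : Measurable fun ω : PathSpace N => (((X, Y), ω) : (Config N × Config N) × PathSpace N) :=
    measurable_const.prodMk measurable_id
  simpa only [Function.comp_def] using (measurable_bridgeWeight_uncurry hv L β).comp hg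

/-- The free heat kernel is jointly measurable. [folklore] -/
theorem measurable_freeHeatKernel_uncurry (β : ℝ) :
    Measurable fun p : Config N × Config N => freeHeatKernel β p.1 p.2 := by
  unfold freeHeatKernel
  refine Finset.measurable_prod _ fun i _ => Finset.measurable_prod _ fun k _ => ?_
  have h1 : Measurable fun p : Config N × Config N => p.1 i k :=
    (measurable_pi_apply k).comp ((WithLp.measurable_ofLp 2 _).comp
      ((measurable_pi_apply i).comp measurable_fst))
  have h2 : Measurable fun p : Config N × Config N => p.2 i k :=
    (measurable_pi_apply k).comp ((WithLp.measurable_ofLp 2 _).comp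
      ((measurable_pi_apply i).comp measurable_snd))
  simp only [gaussianPDF]
  exact ENNReal.measurable_ofReal.comp
    (measurable_uncurry_gaussianPDFReal.comp (h1.prodMk (measurable_const.prodMk h2)))

/-- The free heat kernel is measurable in the second variable. [folklore] -/
theorem measurable_freeHeatKernel_right (β : ℝ) (X : Config N) :
    Measurable (freeHeatKernel β X) := by
  have hg : Measurable fun Y : Config N => (X, Y) := measurable_const.prodMk measurable_id
  simpa only [Function.comp_def] using (measurable_freeHeatKernel_uncurry β).comp hg

/-- **The Feynman–Kac kernel is jointly measurable** (for measurable `v`). [folklore] -/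
theorem measurable_loopKernel_uncurry {v : ℝ → ℝ≥0∞} (hv : Measurable v) (L β : ℝ) :
    Measurable fun p : Config N × Config N => loopKernel v L β p.1 p.2 := by
  have h : Measurable fun p : Config N × Config N => ∫⁻ ω, bridgeWeight v L β p.1 p.2 ω ∂wienerPaths N :=
    (measurable_bridgeWeight_uncurry hv L β).lintegral_prod_right'
  exact (measurable_freeHeatKernel_uncurry β).mul h

/-- The torus kernel is jointly measurable (for measurable `v`). [folklore] -/
theorem measurable_torusKernel_uncurry {v : ℝ → ℝ≥0∞} (hv : Measurable v) (L β : ℝ) :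
    Measurable fun p : Config N × Config N => torusKernel v L β p.1 p.2 := by
  refine Measurable.tsum fun n => ?_
  have hg : Measurable fun p : Config N × Config N => (p.1, p.2 + latticeShift L n) :=
    measurable_fst.prodMk (measurable_snd.add_const _)
  simpa only [Function.comp_def] using (measurable_loopKernel_uncurry hv L β).comp hg

/-- The torus kernel along a permutation, `X ↦ K^per_β(X, X∘σ)`, is measurable. [folklore] -/
theorem measurable_torusKernel_perm {v : ℝ → ℝ≥0∞} (hv : Measurable v) (L β : ℝ)
    (σ : Equiv.Perm (Fin N)) : Measurable fun X : Config N => torusKernel v L β X (X ∘ σ) := by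
  have hg : Measurable fun X : Config N => (X, X ∘ σ) := measurable_id.prodMk (measurable_comp_perm σ)
  simpa only [Function.comp_def] using (measurable_torusKernel_uncurry hv L β).comp hg

/-- The loop density of a sector is measurable (for measurable `v`). [folklore] -/
theorem measurable_loopDensity {v : ℝ → ℝ≥0∞} (hv : Measurable v) (L β : ℝ)
    (σ : Equiv.Perm (Fin N)) (n : Winding N) : Measurable (loopDensity v L β σ n) := by
  have hg : Measurable fun p : Config N × PathSpace N =>
      ((p.1, p.1 ∘ σ + latticeShift L n), p.2) :=
    (measurable_fst.prodMk (((measurable_comp_perm σ).comp measurable_fst).add_const _)).prodMk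
      measurable_snd
  have h1 : Measurable fun p : Config N × PathSpace N =>
      freeHeatKernel β p.1 (p.1 ∘ σ + latticeShift L n) := by
    simpa only [Function.comp_def] using
      (measurable_freeHeatKernel_uncurry β).comp (measurable_fst.comp hg)
  have h2 : Measurable fun p : Config N × PathSpace N =>
      bridgeWeight v L β p.1 (p.1 ∘ σ + latticeShift L n) p.2 := by
    simpa only [Function.comp_def] using (measurable_bridgeWeight_uncurry hv L β).comp hg
  exact h1.mul h2

/-- The loop density is finite. [folklore] -/
theorem loopDensity_lt_top (v : ℝ → ℝ≥0∞) (L β : ℝ) (σ : Equiv.Perm (Fin N)) (n : Winding N)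
    (p : Config N × PathSpace N) : loopDensity v L β σ n p < ⊤ :=
  ENNReal.mul_lt_top (freeHeatKernel_lt_top β _ _) (bridgeWeight_ne_top v L β _ _ _).lt_top

/-- The embedding of a sector into the sample space is a measurable embedding. [folklore] -/
theorem measurableEmbedding_sector (σ : Equiv.Perm (Fin N)) (n : Winding N) :
    MeasurableEmbedding fun p : Config N × PathSpace N => ((σ, n, p) : LoopSample N) :=
  MeasurableEmbedding.prodMk_left σ (MeasurableEmbedding.prodMk_left n MeasurableEmbedding.id)


/-! ### Integration against the loop measure; the partition function as its total mass -/

/-- **Integration against the loop measure, sector by sector**: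
`∫ f dμ_loop = ∑_σ ∑_n (1/N!) ∫ f(σ, n, ·) d(sector measure)`, for EVERY `f ≥ 0`.
[cite: Ueltschi2006, Appendix A (Y(N) as a sum over π ∈ S_N)] -/
theorem lintegral_loopMeasure (v : ℝ → ℝ≥0∞) (N : ℕ) (L β : ℝ) (f : LoopSample N → ℝ≥0∞) :
    ∫⁻ p, f p ∂loopMeasure v N L β =
      ∑ σ : Equiv.Perm (Fin N), ∑' n : Winding N,
        (Nat.factorial N : ℝ≥0∞)⁻¹ * ∫⁻ q, f (σ, n, q) ∂sectorMeasure v L β σ n := by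
  rw [loopMeasure, lintegral_sum_measure, tsum_fintype]
  refine Finset.sum_congr rfl fun σ _ => ?_
  rw [lintegral_sum_measure]
  refine tsum_congr fun n => ?_
  rw [(measurableEmbedding_sector σ n).lintegral_map, lintegral_smul_measure]
  rfl

/-- **Integration against a sector measure** is the iterated integral `dX|_cell dW` of
`density × integrand`, for measurable `v` and measurable `f ≥ 0` (Tonelli). [folklore] -/
theorem lintegral_sectorMeasure {v : ℝ → ℝ≥0∞} (hv : Measurable v) (L β : ℝ)
    (σ : Equiv.Perm (Fin N)) (n : Winding N) {f : Config N × PathSpace N → ℝ≥0∞}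
    (hf : Measurable f) :
    ∫⁻ q, f q ∂sectorMeasure v L β σ n =
      ∫⁻ X in cellN N L, ∫⁻ ω, loopDensity v L β σ n (X, ω) * f (X, ω) ∂wienerPaths N := by
  rw [sectorMeasure, lintegral_withDensity_eq_lintegral_mul _ (measurable_loopDensity hv L β σ n) hf,
    lintegral_prod _ (((measurable_loopDensity hv L β σ n).mul hf).aemeasurable)]
  rfl

/-- The expected density of a sector at a fixed starting point is the kernel:
`∫ p_β(X, Y) e^{-∫V^per} dW = K_β(X, Y)` with `Y = X∘σ + Ln`. [folklore] -/
theorem lintegral_loopDensity {v : ℝ → ℝ≥0∞} (hv : Measurable v) (L β : ℝ)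
    (σ : Equiv.Perm (Fin N)) (n : Winding N) (X : Config N) :
    ∫⁻ ω, loopDensity v L β σ n (X, ω) ∂wienerPaths N =
      loopKernel v L β X (X ∘ σ + latticeShift L n) := by
  simp only [loopDensity]
  rw [lintegral_const_mul _ (measurable_bridgeWeight hv L β _ _), loopKernel]

/-- The total mass of a sector measure: `∫_{[0,L)^{3N}} K_β(X, X∘σ + Ln) dX`. [folklore] -/
theorem sectorMeasure_univ {v : ℝ → ℝ≥0∞} (hv : Measurable v) (L β : ℝ)
    (σ : Equiv.Perm (Fin N)) (n : Winding N) :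
    sectorMeasure v L β σ n Set.univ =
      ∫⁻ X in cellN N L, loopKernel v L β X (X ∘ σ + latticeShift L n) := by
  rw [← setLIntegral_one, Measure.restrict_univ, lintegral_sectorMeasure hv L β σ n measurable_const]
  simp only [mul_one, lintegral_loopDensity hv]

/-- Summing the winding sectors of a permutation gives its term of the partition function:
`∑_n ∫_cell K_β(X, X∘σ + Ln) dX = ∫_cell K^per_β(X, X∘σ) dX`. [cite: Ueltschi2006, Appendix A (Wiener measure W^β_{xy} on the torus as a sum over z ∈ ℤ^d)] -/
theorem tsum_sectorMeasure_univ {v : ℝ → ℝ≥0∞} (hv : Measurable v) (N : ℕ) (L β : ℝ)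
    (σ : Equiv.Perm (Fin N)) :
    ∑' n : Winding N, sectorMeasure v L β σ n Set.univ = permTerm v N L β σ := by
  simp only [sectorMeasure_univ hv, permTerm, torusKernel]
  rw [lintegral_tsum]
  intro n
  have hg : Measurable fun X : Config N => (X, X ∘ σ + latticeShift L n) :=
    measurable_id.prodMk ((measurable_comp_perm σ).add_const _)
  have h : Measurable fun X : Config N => loopKernel v L β X (X ∘ σ + latticeShift L n) := by
    simpa only [Function.comp_def] using (measurable_loopKernel_uncurry hv L β).comp hg
  exact h.aemeasurable

/-- **The total mass of the loop measure is the bosonic partition function**,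
`μ_loop(LoopSample N) = Z_β(N, L) = (1/N!) ∑_σ ∫_{[0,L)^{3N}} K^per_β(X, X∘σ) dX`.
[cite: Ueltschi2006, Appendix A (Y(N) as a sum over π ∈ S_N)] -/
theorem loopMeasure_univ {v : ℝ → ℝ≥0∞} (hv : Measurable v) (N : ℕ) (L β : ℝ) :
    loopMeasure v N L β Set.univ = loopPartition v N L β := by
  rw [← setLIntegral_one, Measure.restrict_univ, lintegral_loopMeasure, loopPartition, Finset.mul_sum]
  refine Finset.sum_congr rfl fun σ _ => ?_
  rw [ENNReal.tsum_mul_left, ← tsum_sectorMeasure_univ hv N L β σ]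
  congr 1
  refine tsum_congr fun n => ?_
  rw [← setLIntegral_one, Measure.restrict_univ]

/-- The loop measure is finite as soon as the partition function is. [folklore] -/
theorem isFiniteMeasure_loopMeasure {v : ℝ → ℝ≥0∞} (hv : Measurable v) {N : ℕ} {L β : ℝ}
    (hZ : loopPartition v N L β ≠ ⊤) : IsFiniteMeasure (loopMeasure v N L β) :=
  ⟨by rw [loopMeasure_univ hv]; exact hZ.lt_top⟩

/-- **The permutation sum.** `Z_β(N, L) = (1/N!) ∑_{σ ∈ S_N} permTerm σ` with every term a
nonnegative number (indeed the mass of a positive measure, `tsum_sectorMeasure_univ`): the bosonic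
Feynman–Kac representation has no signs. [cite: Ueltschi2006, Appendix A (Y(N) as a sum over π ∈ S_N)] -/
theorem loopPartition_eq_sum (v : ℝ → ℝ≥0∞) (N : ℕ) (L β : ℝ) :
    loopPartition v N L β =
      (Nat.factorial N : ℝ≥0∞)⁻¹ * ∑ σ : Equiv.Perm (Fin N), permTerm v N L β σ :=
  rfl

/-- Every term of the permutation sum is nonnegative. [cite: Ueltschi2006, Appendix A (Y(N) as a sum over π ∈ S_N)] -/
theorem permTerm_nonneg (v : ℝ → ℝ≥0∞) (N : ℕ) (L β : ℝ) (σ : Equiv.Perm (Fin N)) :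
    0 ≤ permTerm v N L β σ :=
  zero_le


/-! ### Strict positivity for bounded periodised potentials -/

/-- A bounded periodised potential gives a bounded interaction: `∑_{i<j} v^per ≤ N² C`. [folklore] -/
theorem periodicInteraction_le_of_le {v : ℝ → ℝ≥0∞} {L : ℝ} {C : ℝ≥0∞}
    (hC : ∀ x, periodizedPotential v L x ≤ C) (X : Config N) :
    periodicInteraction v L X ≤ N * N * C := by
  unfold periodicInteraction
  calc ∑ i : Fin N, ∑ j ∈ Finset.univ.filter (fun j => i < j), periodizedPotential v L (X i - X j)
      ≤ ∑ _i : Fin N, ∑ _j : Fin N, C :=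
        Finset.sum_le_sum fun i _ =>
          (Finset.sum_le_sum_of_subset (Finset.filter_subset _ _)).trans
            (Finset.sum_le_sum fun j _ => hC _)
    _ = N * N * C := by
        simp only [Finset.sum_const, Finset.card_univ, Fintype.card_fin, nsmul_eq_mul]
        ring

/-- Hence a bounded action along any bridge: `∫₀^β ∑ v^per ≤ N² C β`. [folklore] -/
theorem bridgeAction_le_of_le {v : ℝ → ℝ≥0∞} {L : ℝ} {C : ℝ≥0∞}
    (hC : ∀ x, periodizedPotential v L x ≤ C) (β : ℝ) (X Y : Config N)
    (ω : PathSpace N) : bridgeAction v L β X Y ω ≤ N * N * C * ENNReal.ofReal β := by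
  calc bridgeAction v L β X Y ω ≤ ∫⁻ _s in Set.Ioc (0 : ℝ) β, N * N * C :=
        lintegral_mono fun s => periodicInteraction_le_of_le hC _
    _ = N * N * C * ENNReal.ofReal β := by
        rw [setLIntegral_const, Real.volume_Ioc, sub_zero]

/-- `e^{-a} > 0` for a finite action. [folklore] -/
theorem expNeg_pos {a : ℝ≥0∞} (ha : a ≠ ⊤) : 0 < expNeg a := by
  rw [expNeg, if_neg ha]
  exact ENNReal.ofReal_pos.2 (Real.exp_pos _)

/-- `expNeg` is antitone. [folklore] -/
theorem expNeg_anti {a b : ℝ≥0∞} (h : a ≤ b) : expNeg b ≤ expNeg a := by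
  rcases eq_or_ne b ⊤ with rfl | hb
  · simp
  have ha : a ≠ ⊤ := ne_top_of_le_ne_top hb h
  rw [expNeg, if_neg hb, expNeg, if_neg ha]
  exact ENNReal.ofReal_le_ofReal (Real.exp_le_exp.2 (neg_le_neg ((ENNReal.toReal_le_toReal ha hb).2 h)))

/-- **The expected bridge weight is strictly positive** for a bounded periodised potential
(it is at least `exp(-N² C β)`). [cite: GlimmJaffeQP1987, §3.3 Thm 3.3.3] -/
theorem lintegral_bridgeWeight_pos {v : ℝ → ℝ≥0∞} {L : ℝ} {C : ℝ≥0}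
    (hC : ∀ x, periodizedPotential v L x ≤ C) (β : ℝ) (X Y : Config N) :
    0 < ∫⁻ ω, bridgeWeight v L β X Y ω ∂wienerPaths N := by
  set b : ℝ≥0∞ := N * N * C * ENNReal.ofReal β with hb
  have hbt : b ≠ ⊤ := by
    refine ENNReal.mul_ne_top (ENNReal.mul_ne_top (ENNReal.mul_ne_top ?_ ?_) ENNReal.coe_ne_top)
      ENNReal.ofReal_ne_top <;> exact ENNReal.natCast_ne_top N
  calc 0 < expNeg b := expNeg_pos hbt
    _ = ∫⁻ _ω, expNeg b ∂wienerPaths N := by rw [lintegral_const, measure_univ, mul_one]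
    _ ≤ ∫⁻ ω, bridgeWeight v L β X Y ω ∂wienerPaths N :=
        lintegral_mono fun ω => expNeg_anti (bridgeAction_le_of_le hC β X Y ω)

/-- **The Feynman–Kac kernel is strictly positive** (bounded periodised potential, `β > 0`).
[cite: GlimmJaffeQP1987, §3.3 Thm 3.3.3 (3.3.4)] -/
theorem loopKernel_pos {v : ℝ → ℝ≥0∞} {L : ℝ} {C : ℝ≥0}
    (hC : ∀ x, periodizedPotential v L x ≤ C) {β : ℝ} (hβ : 0 < β) (X Y : Config N) :
    0 < loopKernel v L β X Y :=
  ENNReal.mul_pos (freeHeatKernel_pos hβ X Y).ne' (lintegral_bridgeWeight_pos hC β X Y).ne'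

/-- The torus kernel is strictly positive (bounded periodised potential, `β > 0`). [cite: GlimmJaffeQP1987, §3.3 Thm 3.3.3 (3.3.4)] -/
theorem torusKernel_pos {v : ℝ → ℝ≥0∞} {L : ℝ} {C : ℝ≥0}
    (hC : ∀ x, periodizedPotential v L x ≤ C) {β : ℝ} (hβ : 0 < β) (X Y : Config N) :
    0 < torusKernel v L β X Y :=
  (loopKernel_pos hC hβ X _).trans_le (loopKernel_le_torusKernel v L β X Y 0)

/-- The `N`-particle cell has positive volume for `L > 0`. [folklore] -/
theorem volume_cellN_pos (N : ℕ) {L : ℝ} (hL : 0 < L) : 0 < volume (cellN N L) := by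
  rw [volume_cellN]
  exact ENNReal.pow_pos (ENNReal.pow_pos (ENNReal.ofReal_pos.2 hL) 3) N

/-- **Every term of the permutation sum is strictly positive** for a measurable profile with
bounded periodisation, `L > 0`, `β > 0`: each `σ ∈ S_N` genuinely contributes.
[cite: Ueltschi2006, Appendix A (Y(N) as a sum over π ∈ S_N)] -/
theorem permTerm_pos {v : ℝ → ℝ≥0∞} (hv : Measurable v) {L : ℝ} (hL : 0 < L) {C : ℝ≥0}
    (hC : ∀ x, periodizedPotential v L x ≤ C) {β : ℝ} (hβ : 0 < β) (σ : Equiv.Perm (Fin N)) :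
    0 < permTerm v N L β σ := by
  rw [permTerm, lintegral_pos_iff_support (measurable_torusKernel_perm hv L β σ)]
  have hsupp : Function.support (fun X : Config N => torusKernel v L β X (X ∘ σ)) = Set.univ :=
    Set.eq_univ_of_forall fun X => (torusKernel_pos hC hβ X _).ne'
  rw [hsupp, Measure.restrict_apply_univ]
  exact volume_cellN_pos N hL

/-- **The partition function is strictly positive** (same hypotheses). [cite: Ueltschi2006, Appendix A (Y(N) as a sum over π ∈ S_N)] -/
theorem loopPartition_pos {v : ℝ → ℝ≥0∞} (hv : Measurable v) (N : ℕ) {L : ℝ} (hL : 0 < L) {C : ℝ≥0}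
    (hC : ∀ x, periodizedPotential v L x ≤ C) {β : ℝ} (hβ : 0 < β) :
    0 < loopPartition v N L β := by
  refine ENNReal.mul_pos (ENNReal.inv_ne_zero.2 (ENNReal.natCast_ne_top _)) fun hsum => ?_
  exact (permTerm_pos hv hL hC hβ 1).ne' (Finset.sum_eq_zero_iff.1 hsum 1 (Finset.mem_univ _))

/-! ### No particles -/

/-- The empty configuration space is the whole cell. [folklore] -/
theorem cellN_zero (L : ℝ) : cellN 0 L = Set.univ :=
  Set.eq_univ_of_forall fun _ i => Fin.elim0 i

/-- With no particles the kernel is `1` (empty products, empty interaction). [folklore] -/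
theorem loopKernel_zero_particles (v : ℝ → ℝ≥0∞) (L β : ℝ) (X Y : Config 0) :
    loopKernel v L β X Y = 1 := by
  have hw : ∀ ω : PathSpace 0, bridgeWeight v L β X Y ω = 1 := fun ω => by
    simp [bridgeWeight, bridgeAction, periodicInteraction]
  simp [loopKernel, freeHeatKernel, hw]

/-- **`Z_β(0, L) = 1`**: the partition function of no particles is one, Ueltschi's convention
`Y(0) = 1` holding by computation. [cite: Ueltschi2006, §2.1 (Y(0) = 1)] -/
theorem loopPartition_zero_particles (v : ℝ → ℝ≥0∞) (L β : ℝ) : loopPartition v 0 L β = 1 := by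
  have hK : ∀ X Y : Config 0, torusKernel v L β X Y = 1 := fun X Y => by
    rw [torusKernel, tsum_fintype, Finset.univ_unique, Finset.sum_singleton,
      loopKernel_zero_particles]
  simp only [loopPartition, permTerm, hK, Nat.factorial_zero, Nat.cast_one, inv_one, one_mul,
    Finset.univ_unique, Finset.sum_singleton, lintegral_const, Measure.restrict_apply,
    MeasurableSet.univ, Set.univ_inter, cellN_zero, one_mul]
  rw [volume_pi, Measure.pi_univ, Finset.univ_eq_empty, Finset.prod_empty]


/-! ### The world-lines of a sample -/

/-- The terminal configuration in coordinates: particle `i` ends at `X_{σ i} + L nᵢ`. [cite: Ueltschi2006, Appendix A (Y(N) as a sum over π ∈ S_N)] -/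
theorem LoopSample.finish_apply (L : ℝ) (p : LoopSample N) (i : Fin N) :
    p.finish L i = p.start (p.perm i) + latticeVec L (p.winding i) :=
  rfl

/-- The world-lines of a sample start at its starting configuration. [folklore] -/
@[simp] theorem loopLine_zero (L β : ℝ) (p : LoopSample N) : loopLine L β p 0 = p.start :=
  bridgeLine_zero β _ _ _

/-- The world-lines of a sample end at the permuted, shifted configuration `(X_{σ i} + L nᵢ)ᵢ`
(`β ≠ 0`). [cite: Ueltschi2006, Appendix A (Y(N) as a sum over π ∈ S_N)] -/
@[simp] theorem loopLine_self (L : ℝ) {β : ℝ} (hβ : β ≠ 0) (p : LoopSample N) :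
    loopLine L β p β = p.finish L :=
  bridgeLine_self hβ _ _ _

/-- Every world-line of a sample is continuous. [folklore] -/
theorem continuous_loopLine (L β : ℝ) (p : LoopSample N) : Continuous (loopLine L β p) :=
  continuous_bridgeLine β _ _ _

/-- **Measurability on the sample space reduces to the continuous coordinates**: a function of
loop samples is measurable as soon as it is measurable in `(X, ω)` for each sector `(σ, n)`
(the discrete coordinates range over countable sets). [folklore] -/
theorem measurable_of_sector {γ : Type*} [MeasurableSpace γ] {f : LoopSample N → γ}
    (hf : ∀ (σ : Equiv.Perm (Fin N)) (n : Winding N),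
      Measurable fun q : Config N × PathSpace N => f (σ, n, q)) :
    Measurable f :=
  measurable_from_prod_countable_right fun σ =>
    measurable_from_prod_countable_right fun n => hf σ n

/-- The position of the world-lines at a fixed time is a measurable function of the sample. [folklore] -/
theorem measurable_loopLine_at (L β s : ℝ) : Measurable fun p : LoopSample N => loopLine L β p s := by
  refine measurable_of_sector fun σ n => ?_
  have hg : Measurable fun q : Config N × PathSpace N =>
      (((q.1, q.1 ∘ σ + latticeShift L n), q.2) : (Config N × Config N) × PathSpace N) :=
    (measurable_fst.prodMk (((measurable_comp_perm σ).comp measurable_fst).add_const _)).prodMk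
      measurable_snd
  simpa only [Function.comp_def, loopLine, LoopSample.finish, LoopSample.start, LoopSample.perm,
    LoopSample.winding, LoopSample.path] using (measurable_bridgeLine_at β s).comp hg

/-- The world-lines are jointly measurable in (time, sample) (continuous in time, measurable in
the sample). [folklore] -/
theorem measurable_loopLine_uncurry (L β : ℝ) :
    Measurable (Function.uncurry fun (s : ℝ) (p : LoopSample N) => loopLine L β p s) :=
  measurable_uncurry_of_continuous_of_measurable (fun p => continuous_loopLine L β p)
    (fun s => measurable_loopLine_at L β s)

/-! ### The one-particle density matrix: algebra -/

/-- No particles, no density matrix. [folklore] -/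
@[simp] theorem openLineKernel_zero_particles (v : ℝ → ℝ≥0∞) (L β : ℝ) (x y : Space) :
    openLineKernel v 0 L β x y = 0 :=
  rfl

/-- Unfolding the open-line weight for `N = n + 1` particles. [cite: KonigVogelZass2025, §5, proof of Lemma 1.2 (formula for γ_N(x,y))] -/
theorem openLineKernel_succ (v : ℝ → ℝ≥0∞) (n : ℕ) (L β : ℝ) (x y : Space) :
    openLineKernel v (n + 1) L β x y = ((Nat.factorial (n + 1) : ℝ≥0∞))⁻¹ *
      ∑ σ : Equiv.Perm (Fin (n + 1)),
        ∫⁻ U in cellN n L, torusKernel v L β (Matrix.vecCons x U) (Matrix.vecCons y U ∘ σ) :=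
  rfl

/-- No particles, no density matrix. [folklore] -/
@[simp] theorem loopDensityMatrix_zero_particles (v : ℝ → ℝ≥0∞) (L β : ℝ) (x y : Space) :
    loopDensityMatrix v 0 L β x y = 0 := by
  simp [loopDensityMatrix]

/-- The density matrix read in `ℝ`: `γ_β(x,y) = N · w_β(x,y) / Z_β` as real numbers (all
conventions `⊤.toReal = 0`, `x/0 = 0` being Lean's). [cite: KonigVogelZass2025, §5, proof of Lemma 1.2 (formula for γ_N(x,y))] -/
theorem toReal_loopDensityMatrix (v : ℝ → ℝ≥0∞) (N : ℕ) (L β : ℝ) (x y : Space) :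
    (loopDensityMatrix v N L β x y).toReal =
      N * (openLineKernel v N L β x y).toReal / (loopPartition v N L β).toReal := by
  rw [loopDensityMatrix, ENNReal.toReal_div, ENNReal.toReal_mul, ENNReal.toReal_natCast]

/-- **`⟨f, γ_β g⟩ = N · (open-line integral) / Z_β`**: the quadratic form of the one-particle
density matrix is `N/Z` times the loop-gas integral with one open world-line weighted by
`conj f` at its start and `g` at its end. [cite: KonigVogelZass2025, §5, proof of Lemma 1.2 (formula for γ_N(x,y))] -/
theorem loopDensityMatrixForm_eq (v : ℝ → ℝ≥0∞) (N : ℕ) (L β : ℝ) (f g : Space → ℂ) :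
    loopDensityMatrixForm v N L β f g =
      ((N : ℝ) / (loopPartition v N L β).toReal : ℂ) *
        ∫ x in cell L, ∫ y in cell L,
          conj (f x) * ((openLineKernel v N L β x y).toReal : ℂ) * g y := by
  simp only [loopDensityMatrixForm, toReal_loopDensityMatrix]
  rw [← integral_const_mul]
  refine integral_congr_ae (Eventually.of_forall fun x => ?_)
  simp only
  rw [← integral_const_mul]
  refine integral_congr_ae (Eventually.of_forall fun y => ?_)
  simp only
  push_cast
  ring

/-- The condensate occupation of the Gibbs state, unfolded: `L⁻³ ∫_cell ∫_cell γ_β`. [cite: Ueltschi2006, Appendix A (ϱ⁽⁰⁾_ρ and Tr(N_φ e^{-βH}))] -/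
theorem loopCondensateOccupation_eq (v : ℝ → ℝ≥0∞) (N : ℕ) (L β : ℝ) :
    loopCondensateOccupation v N L β =
      (ENNReal.ofReal L ^ 3)⁻¹ * ∫⁻ x in cell L, ∫⁻ y in cell L, loopDensityMatrix v N L β x y :=
  rfl


/-! ### The bridge measure represents the kernel of the semigroup

The Feynman–Kac kernel integrates the open-world-line functional of `PeriodicHeatFlow.lean`:
`∫ K_β(X, Y) g(Y) dY = E_X[e^{-∫₀^β V^per(B_s)ds} g(B_β)] = periodicFKSemigroup v L β g X`. The proof
is the disintegration of Wiener measure along the endpoint: the bridge parts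
`(bⁱᵏ_s - (s/β) bⁱᵏ_β)_{s ≤ β}` of the `3N` coordinates are independent of the endpoints `bⁱᵏ_β`
(`indepFun_rawBridgePast` of the tree, coordinate-wise, assembled by `indepFun_pi_map`), the
world-line is the bridge line ending at its own endpoint, and the law of the endpoint configuration
is `p_β(X, Y) dY` (`map_worldLine`). Functionals of the bridge part are read through the raw-path
functionals of `GroundStateFeynmanKacSemigroup.lean` (regularisation `pathRegularize`, the identity
on continuous paths), which are jointly measurable. -/

section Disintegration

open Literature.Probability.Process (rawBridgePast measurable_rawBridgePast indepFun_rawBridgePast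
  lintegral_comp_eq_lintegral_lintegral_of_indepFun pathRegularize pathRegularize_eq_self_of_continuous)

/-- The bridge parts `(bⁱᵏ_s - (s/t) bⁱᵏ_t)_{s ≤ t}` of all `3N` coordinates. [folklore] -/
def pathsBridge (t : ℝ≥0) (ω : PathSpace N) : Fin N → Fin 3 → Set.Iic t → ℝ :=
  fun i k => rawBridgePast t (ω i k)

/-- The endpoints `bⁱᵏ_t` of all `3N` coordinates. [folklore] -/
def pathsEnd (t : ℝ≥0) (ω : PathSpace N) : Fin N → Fin 3 → ℝ :=
  fun i k => brownian t (ω i k)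

/-- The stopped extension of a family of bridge parts to paths on `ℝ≥0` (constant after `t`). [folklore] -/
def bridgeExt (t : ℝ≥0) (r : Fin N → Fin 3 → Set.Iic t → ℝ) : PathSpace N :=
  fun i k u => r i k ⟨min u t, min_le_right u t⟩

/-- The endpoint configuration `X + √2 e`. [folklore] -/
def endConfig (X : Config N) (e : Fin N → Fin 3 → ℝ) : Config N :=
  fun i => X i + WithLp.toLp 2 (fun k => Real.sqrt 2 * e i k)

/-- `pathsBridge` is measurable. [folklore] -/
theorem measurable_pathsBridge (t : ℝ≥0) : Measurable (pathsBridge (N := N) t) :=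
  measurable_pi_lambda _ fun i => measurable_pi_lambda _ fun k =>
    (measurable_rawBridgePast t).comp ((measurable_pi_apply k).comp (measurable_pi_apply i))

/-- `pathsEnd` is measurable. [folklore] -/
theorem measurable_pathsEnd (t : ℝ≥0) : Measurable (pathsEnd (N := N) t) :=
  measurable_pi_lambda _ fun i => measurable_pi_lambda _ fun k =>
    (measurable_brownian t).comp ((measurable_pi_apply k).comp (measurable_pi_apply i))

/-- `bridgeExt` is measurable (pointwise evaluations). [folklore] -/
theorem measurable_bridgeExt (t : ℝ≥0) : Measurable (bridgeExt (N := N) t) :=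
  measurable_pi_lambda _ fun i => measurable_pi_lambda _ fun k => measurable_pi_lambda _ fun _ =>
    (measurable_pi_apply _).comp ((measurable_pi_apply k).comp (measurable_pi_apply i))

/-- `endConfig X` is measurable. [folklore] -/
theorem measurable_endConfig (X : Config N) : Measurable (endConfig X) :=
  measurable_pi_lambda _ fun i => measurable_const.add ((WithLp.measurable_toLp 2 _).comp
    (measurable_pi_lambda _ fun k => measurable_const.mul
      ((measurable_pi_apply k).comp (measurable_pi_apply i))))

/-- The world-line at time `t` is the endpoint configuration of the endpoints. [folklore] -/
theorem worldLine_eq_endConfig (X : Config N) (ω : PathSpace N) (t : ℝ≥0) :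
    worldLine X ω t = endConfig X (pathsEnd t ω) :=
  rfl

/-- **Bridge parts ⟂ endpoints for the `3N` Brownian coordinates** (`indepFun_rawBridgePast` in
each coordinate, assembled across the product measure by `indepFun_pi_map`, twice).
[cite: RevuzYor1999, Ch. I §3 (Brownian Bridge)] -/
theorem indepFun_pathsBridge_pathsEnd (t : ℝ≥0) :
    IndepFun (pathsBridge (N := N) t) (pathsEnd t) (wienerPaths N) := by
  haveI := Literature.Probability.RandomPlanarGeometry.isProbabilityMeasure_preWienerMeasure'
  have h1 : IndepFun (rawBridgePast t) (brownian t) preWienerMeasure := indepFun_rawBridgePast t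
  have h3 : IndepFun (fun (η : Fin 3 → ℝ≥0 → ℝ) (k : Fin 3) => rawBridgePast t (η k))
      (fun (η : Fin 3 → ℝ≥0 → ℝ) (k : Fin 3) => brownian t (η k))
      (Measure.pi fun _ : Fin 3 => preWienerMeasure) :=
    indepFun_pi_map (fun _ => h1) (fun _ => measurable_rawBridgePast t) (fun _ => measurable_brownian t)
  exact indepFun_pi_map (μ := fun _ : Fin N => Measure.pi fun _ : Fin 3 => preWienerMeasure)
    (fun _ => h3)
    (fun _ => measurable_pi_lambda _ fun k => (measurable_rawBridgePast t).comp (measurable_pi_apply k))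
    (fun _ => measurable_pi_lambda _ fun k => (measurable_brownian t).comp (measurable_pi_apply k))

/-- Hence the bridge parts are independent of the endpoint configuration `B_t = X + √2 b_t`. [folklore] -/
theorem indepFun_pathsBridge_worldLine (X : Config N) (t : ℝ≥0) :
    IndepFun (pathsBridge (N := N) t) (fun ω => worldLine X ω t) (wienerPaths N) :=
  (indepFun_pathsBridge_pathsEnd t).comp measurable_id (measurable_endConfig X)

/-- The **raw bridge line** `X + (s/β)(Y - X) + √2 w̄(s⁺)` of a raw path family `w`
(`w̄ = pathRegularize w` coordinate-wise). [folklore] -/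
def rawBridgeLine (β : ℝ) (X Y : Config N) (w : PathSpace N) (s : ℝ) : Config N :=
  (fun i : Fin N => X i + WithLp.toLp 2 (fun k : Fin 3 =>
    Real.sqrt 2 * pathRegularize (w i k) s.toNNReal)) + (s / β) • (Y - X)

/-- The raw bridge line is jointly measurable in (end, raw paths, time). [folklore] -/
theorem measurable_rawBridgeLine (β : ℝ) (X : Config N) :
    Measurable fun q : (Config N × PathSpace N) × ℝ => rawBridgeLine β X q.1.1 q.1.2 q.2 := by
  unfold rawBridgeLine
  have hg : Measurable fun q : (Config N × PathSpace N) × ℝ => ((X, q.1.2), q.2) := by fun_prop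
  have h1 : Measurable fun q : (Config N × PathSpace N) × ℝ => fun i : Fin N =>
      X i + WithLp.toLp 2 (fun k : Fin 3 => Real.sqrt 2 * pathRegularize (q.1.2 i k) q.2.toNNReal) := by
    simpa only [Function.comp_def] using (measurable_rawWorldLine N).comp hg
  have h2 : Measurable fun q : (Config N × PathSpace N) × ℝ => (q.2 / β) • (q.1.1 - X) :=
    (measurable_snd.div_const β).smul ((measurable_fst.comp measurable_fst).sub_const X)
  exact h1.add h2

/-- The **raw bridge weight** `e^{-∫₀^β ∑ v^per(raw bridge line)}` as a functional of
(end, raw paths). [folklore] -/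
def rawBridgeWeight (v : ℝ → ℝ≥0∞) (L β : ℝ) (X : Config N) (p : Config N × PathSpace N) : ℝ≥0∞ :=
  expNeg (∫⁻ s in Set.Ioc (0 : ℝ) β, periodicInteraction v L (rawBridgeLine β X p.1 p.2 s))

/-- The raw bridge weight is measurable (Tonelli). [folklore] -/
theorem measurable_rawBridgeWeight {v : ℝ → ℝ≥0∞} (hv : Measurable v) (L β : ℝ) (X : Config N) :
    Measurable (rawBridgeWeight v L β X) :=
  measurable_expNeg.comp
    ((measurable_periodicInteraction hv L).comp (measurable_rawBridgeLine β X)).lintegral_prod_right'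

/-- The stopped bridge part of a Brownian sample is a continuous path. [folklore] -/
theorem continuous_bridgeExt_pathsBridge (t : ℝ≥0) (ω : PathSpace N) (i : Fin N) (k : Fin 3) :
    Continuous (bridgeExt t (pathsBridge t ω) i k) := by
  have h : bridgeExt t (pathsBridge t ω) i k =
      fun u : ℝ≥0 => brownian (min u t) (ω i k) - ((min u t : ℝ≥0) : ℝ) / t * brownian t (ω i k) := rfl
  rw [h]
  have hmin : Continuous fun u : ℝ≥0 => min u t := continuous_id.min continuous_const
  exact ((continuous_brownian (ω i k)).comp hmin).sub
    ((NNReal.continuous_coe.comp hmin).div_const _ |>.mul continuous_const)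

/-- **On a Brownian sample the raw bridge line of the stopped bridge part is the bridge line**
(for `0 ≤ s ≤ β`, `0 < β`): `X + (s/β)(Y - X) + √2 (b_s - (s/β) b_β) = bridgeLine β X Y ω s`.
[cite: RevuzYor1999, Ch. I §3 (Brownian Bridge)] -/
theorem rawBridgeLine_bridgeExt {β : ℝ} (hβ : 0 < β) (X Y : Config N) (ω : PathSpace N) {s : ℝ}
    (hs0 : 0 ≤ s) (hs : s ≤ β) :
    rawBridgeLine β X Y (bridgeExt β.toNNReal (pathsBridge β.toNNReal ω)) s = bridgeLine β X Y ω s := by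
  have hst : min s.toNNReal β.toNNReal = s.toNNReal := min_eq_left (Real.toNNReal_le_toNNReal hs)
  have hraw := raw_worldLine_of_continuous X (w := bridgeExt β.toNNReal (pathsBridge β.toNNReal ω))
    (fun i k => continuous_bridgeExt_pathsBridge _ ω i k) s.toNNReal
  rw [rawBridgeLine, hraw]
  funext i
  rw [Pi.add_apply]
  ext k
  simp only [PiLp.add_apply, Pi.smul_apply, Pi.sub_apply, PiLp.smul_apply,
    PiLp.sub_apply, smul_eq_mul, bridgeLine_apply, bridgeExt, pathsBridge, rawBridgePast, hst]
  have h1 : ((s.toNNReal : ℝ≥0) : ℝ) = s := Real.coe_toNNReal _ hs0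
  have h2 : ((β.toNNReal : ℝ≥0) : ℝ) = β := Real.coe_toNNReal _ hβ.le
  rw [h1, h2]
  ring

/-- Hence the raw bridge weight of the stopped bridge part is the bridge weight. [folklore] -/
theorem rawBridgeWeight_bridgeExt {v : ℝ → ℝ≥0∞} (L : ℝ) {β : ℝ} (hβ : 0 < β) (X Y : Config N)
    (ω : PathSpace N) :
    rawBridgeWeight v L β X (Y, bridgeExt β.toNNReal (pathsBridge β.toNNReal ω)) =
      bridgeWeight v L β X Y ω := by
  rw [rawBridgeWeight, bridgeWeight, bridgeAction]
  congr 1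
  refine setLIntegral_congr_fun measurableSet_Ioc fun s hs => ?_
  rw [rawBridgeLine_bridgeExt hβ X Y ω hs.1.le hs.2]

/-- **The open world-line is the bridge line to its own endpoint**, so the periodic Feynman–Kac
weight of `PeriodicHeatFlow.lean` is the bridge weight at `Y = B_β`. [folklore] -/
theorem periodicFKWeight_eq_bridgeWeight (v : ℝ → ℝ≥0∞) (L β : ℝ) (X : Config N) (ω : PathSpace N) :
    periodicFKWeight v L β X ω = bridgeWeight v L β X (worldLine X ω β.toNNReal) ω := by
  simp [periodicFKWeight, bridgeWeight, periodicPathAction, bridgeAction, bridgeLine]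

/-- **The Feynman–Kac kernel is the kernel of the Feynman–Kac semigroup**:
`∫ K_β(X, Y) g(Y) dY = E_X[exp(-∫₀^β ∑_{i<j} v^per(Bⁱ_s - Bʲ_s) ds) g(B_β)] = periodicFKSemigroup v L β g X`
for measurable `v`, `g ≥ 0` and `β > 0` — the disintegration of Wiener measure into Brownian
bridges against the heat kernel (Glimm–Jaffe (3.1.10)–(3.1.14) with (3.2.5); Revuz–Yor Ch. I
Ex. (3.16)). [cite: GlimmJaffeQP1987, §3.1 (3.1.14) and §3.2 (3.2.5)] -/
theorem lintegral_loopKernel_mul {v : ℝ → ℝ≥0∞} (hv : Measurable v) (L : ℝ) {β : ℝ} (hβ : 0 < β)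
    (X : Config N) {g : Config N → ℝ≥0∞} (hg : Measurable g) :
    ∫⁻ Y, loopKernel v L β X Y * g Y = periodicFKSemigroup v L β g X := by
  have ht : β.toNNReal ≠ 0 := (Real.toNNReal_pos.2 hβ).ne'
  -- the functional of (bridge part, endpoint)
  set F : (Fin N → Fin 3 → Set.Iic β.toNNReal → ℝ) × Config N → ℝ≥0∞ :=
    fun q => rawBridgeWeight v L β X (q.2, bridgeExt β.toNNReal q.1) * g q.2 with hFdef
  have hF : Measurable F :=
    ((measurable_rawBridgeWeight hv L β X).comp
      (measurable_snd.prodMk ((measurable_bridgeExt β.toNNReal).comp measurable_fst))).mul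
      (hg.comp measurable_snd)
  have hU : Measurable (pathsBridge (N := N) β.toNNReal) := measurable_pathsBridge _
  have hξ : Measurable fun ω : PathSpace N => worldLine X ω β.toNNReal := measurable_worldLine X _
  -- Step 1: the semigroup as `E[F(U, ξ)]`
  have h1 : periodicFKSemigroup v L β g X =
      ∫⁻ ω, F (pathsBridge β.toNNReal ω, worldLine X ω β.toNNReal) ∂wienerPaths N := by
    refine lintegral_congr fun ω => ?_
    simp only [hFdef]
    rw [rawBridgeWeight_bridgeExt L hβ, periodicFKWeight_eq_bridgeWeight]
  -- Step 2: independence and the law of the endpoint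
  rw [h1, lintegral_comp_eq_lintegral_lintegral_of_indepFun hU hξ
    (indepFun_pathsBridge_worldLine X β.toNNReal) hF, map_worldLine X ht]
  have h2 : ∀ ω : PathSpace N, ∫⁻ Y, F (pathsBridge β.toNNReal ω, Y)
      ∂(volume : Measure (Config N)).withDensity
        (fun Y => ∏ i, ∏ k, gaussianPDF (X i k) (2 * β.toNNReal) (Y i k)) =
      ∫⁻ Y, freeHeatKernel β X Y * F (pathsBridge β.toNNReal ω, Y) := fun ω =>
    lintegral_withDensity_eq_lintegral_mul _ (measurable_heatKernel X _)
      (hF.comp (measurable_const.prodMk measurable_id))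
  simp_rw [h2]
  -- Step 3: Tonelli and evaluation
  have hG : Measurable fun q : PathSpace N × Config N =>
      freeHeatKernel β X q.2 * F (pathsBridge β.toNNReal q.1, q.2) :=
    ((measurable_freeHeatKernel_right β X).comp measurable_snd).mul
      (hF.comp ((hU.comp measurable_fst).prodMk measurable_snd))
  rw [lintegral_lintegral_swap hG.aemeasurable]
  refine lintegral_congr fun Y => ?_
  simp only [hFdef, rawBridgeWeight_bridgeExt L hβ]
  rw [lintegral_const_mul _ ((measurable_bridgeWeight hv L β X Y).mul_const _),
    lintegral_mul_const _ (measurable_bridgeWeight hv L β X Y), loopKernel, mul_assoc]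

/-- In particular `∫ K_β(X, Y) dY = E_X[e^{-∫₀^β V^per}] = periodicFKSemigroup v L β 1 X ≤ 1`: the
kernel is a sub-probability density in `Y`. [cite: GlimmJaffeQP1987, §3.1 (3.1.14)] -/
theorem lintegral_loopKernel {v : ℝ → ℝ≥0∞} (hv : Measurable v) (L : ℝ) {β : ℝ} (hβ : 0 < β)
    (X : Config N) : ∫⁻ Y, loopKernel v L β X Y = periodicFKSemigroup v L β (fun _ => 1) X := by
  simpa using lintegral_loopKernel_mul hv L hβ X (g := fun _ => 1) measurable_const

end Disintegration

/-! ### The zero-temperature limit `β → ∞`: the link to the variational ground state -/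

/-- **`Ψ₀` is the ground state of `H_N^per` on the torus, reached by the loop gas as `β → ∞`**
(hypothesis structure; the torus analogue of `IsGroundStateFK`, stated at the level of the
Feynman–Kac KERNEL so that it bears directly on the loop-gas objects). `Ψ₀ : (ℝ³)^N → ℝ` is
measurable, nonnegative, `Lℤ³`-periodic in every particle, Bose symmetric and normalised on the
fundamental cell; the variational ground-state energy `E₀ = periodicGroundStateEnergy v N L`
(infimum of the periodic quadratic form over the symmetric `C¹` periodic core `PeriodicTrialState`)
is finite; and `E₀` is the exponential decay rate of the torus kernel with rank-one residue
`Ψ₀ ⊗ Ψ₀`: `e^{βE₀} K^per_β(X, Y) → Ψ₀(X) Ψ₀(Y)` pointwise, with `e^{βE₀} K^per_β` uniformly bounded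
for large `β` (ground-state projection `e^{βE₀} e^{-βH} → |Ψ₀⟩⟨Ψ₀|`, Glimm–Jaffe (3.4.2), for the
compact-resolvent operator `H_N^per` whose ground state is nondegenerate and strictly positive by
the positivity of the kernel, Glimm–Jaffe Thms 3.3.2–3.3.3; the bosonic ground state is then the
absolute one). For bounded measurable `v` these are theorems of the torus theory (to be supplied
with the spectral layer of `PeriodicHeatFlow`); here they are the hypotheses under which the
`β → ∞` limits of the loop gas are computed (`tendsto_loopFreeEnergy` etc.).
[cite: GlimmJaffeQP1987, §3.3 Thms 3.3.2–3.3.3 and §3.4 (3.4.2)] -/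
structure IsLoopGroundState {N : ℕ} (v : ℝ → ℝ≥0∞) (L : ℝ) (Ψ₀ : Config N → ℝ) : Prop where
  /-- `Ψ₀` is Borel measurable. -/
  measurable : Measurable Ψ₀
  /-- `Ψ₀ ≥ 0` (Perron–Frobenius phase). -/
  nonneg : ∀ X, 0 ≤ Ψ₀ X
  /-- Periodicity in every particle and axis: `Ψ₀(…, xᵢ + L e_k, …) = Ψ₀(…, xᵢ, …)`. -/
  periodic : ∀ (X : Config N) (i : Fin N) (k : Fin 3),
    Ψ₀ (X + Pi.single i (EuclideanSpace.single k L)) = Ψ₀ X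
  /-- Bose symmetry. -/
  symm : ∀ (σ : Equiv.Perm (Fin N)) (X : Config N), Ψ₀ (X ∘ σ) = Ψ₀ X
  /-- Normalisation on the fundamental cell, `∫_{[0,L)^{3N}} Ψ₀² = 1`. -/
  norm_eq : ∫⁻ X in cellN N L, ENNReal.ofReal (Ψ₀ X) ^ 2 = 1
  /-- The variational ground-state energy is finite. -/
  energy_ne_top : periodicGroundStateEnergy v N L ≠ ⊤
  /-- Ground-state projection of the kernel: `e^{βE₀} K^per_β(X, Y) → Ψ₀(X) Ψ₀(Y)`. -/
  kernel_tendsto : ∀ X Y : Config N,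
    Tendsto (fun β : ℝ => ENNReal.ofReal (Real.exp ((periodicGroundStateEnergy v N L).toReal * β)) *
      torusKernel v L β X Y) atTop (𝓝 (ENNReal.ofReal (Ψ₀ X) * ENNReal.ofReal (Ψ₀ Y)))
  /-- Uniform bound on the renormalised kernel for large `β`. -/
  kernel_bound : ∃ C : ℝ≥0, ∀ᶠ β : ℝ in atTop, ∀ X Y : Config N,
    ENNReal.ofReal (Real.exp ((periodicGroundStateEnergy v N L).toReal * β)) *
      torusKernel v L β X Y ≤ C

namespace IsLoopGroundState

variable {v : ℝ → ℝ≥0∞} {L : ℝ} {Ψ₀ : Config N → ℝ}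

/-- `Ψ₀ ⊗ Ψ₀` inherits the kernel bound: `Ψ₀(X) Ψ₀(Y) ≤ C`. [folklore] -/
theorem ofReal_mul_ofReal_le (h : IsLoopGroundState v L Ψ₀) :
    ∃ C : ℝ≥0, ∀ X Y : Config N, ENNReal.ofReal (Ψ₀ X) * ENNReal.ofReal (Ψ₀ Y) ≤ C := by
  obtain ⟨C, hC⟩ := h.kernel_bound
  refine ⟨C, fun X Y => le_of_tendsto (h.kernel_tendsto X Y) ?_⟩
  filter_upwards [hC] with β hβ using hβ X Y

/-- **The renormalised permutation terms converge**: for every `σ`,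
`e^{βE₀} ∫_cell K^per_β(X, X∘σ) dX → ∫_cell Ψ₀(X) Ψ₀(X∘σ) dX = ∫_cell Ψ₀² = 1` (dominated
convergence on the cell, Bose symmetry of `Ψ₀`). [cite: GlimmJaffeQP1987, §3.4 (3.4.2)] -/
theorem tendsto_exp_mul_permTerm (h : IsLoopGroundState v L Ψ₀) (hv : Measurable v)
    (σ : Equiv.Perm (Fin N)) :
    Tendsto (fun β : ℝ => ENNReal.ofReal (Real.exp ((periodicGroundStateEnergy v N L).toReal * β)) *
      permTerm v N L β σ) atTop (𝓝 1) := by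
  obtain ⟨C, hC⟩ := h.kernel_bound
  have hlim : Tendsto (fun β : ℝ => ∫⁻ X in cellN N L,
      ENNReal.ofReal (Real.exp ((periodicGroundStateEnergy v N L).toReal * β)) *
        torusKernel v L β X (X ∘ σ)) atTop (𝓝 (∫⁻ X in cellN N L, ENNReal.ofReal (Ψ₀ X) ^ 2)) := by
    refine tendsto_lintegral_filter_of_dominated_convergence (fun _ => (C : ℝ≥0∞)) ?_ ?_ ?_ ?_
    · exact Eventually.of_forall fun β =>
        (measurable_torusKernel_perm hv L β σ).const_mul _
    · filter_upwards [hC] with β hβ using Eventually.of_forall fun X => hβ X _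
    · rw [setLIntegral_const, volume_cellN]
      exact ENNReal.mul_ne_top ENNReal.coe_ne_top
        (ENNReal.pow_ne_top (ENNReal.pow_ne_top ENNReal.ofReal_ne_top))
    · refine Eventually.of_forall fun X => ?_
      have := h.kernel_tendsto X (X ∘ σ)
      rwa [h.symm σ X, ← sq] at this
  rw [h.norm_eq] at hlim
  refine hlim.congr fun β => ?_
  rw [permTerm, lintegral_const_mul _ (measurable_torusKernel_perm hv L β σ)]

/-- **The renormalised partition function tends to one**: `e^{βE₀} Z_β(N, L) → 1` as `β → ∞`
(each of the `N!` permutation terms tends to `∫Ψ₀² = 1`). [cite: GlimmJaffeQP1987, §3.4 (3.4.2)] -/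
theorem tendsto_exp_mul_loopPartition (h : IsLoopGroundState v L Ψ₀) (hv : Measurable v) :
    Tendsto (fun β : ℝ => ENNReal.ofReal (Real.exp ((periodicGroundStateEnergy v N L).toReal * β)) *
      loopPartition v N L β) atTop (𝓝 1) := by
  have hsum : Tendsto (fun β : ℝ => ∑ σ : Equiv.Perm (Fin N),
      ENNReal.ofReal (Real.exp ((periodicGroundStateEnergy v N L).toReal * β)) * permTerm v N L β σ)
      atTop (𝓝 (∑ _σ : Equiv.Perm (Fin N), (1 : ℝ≥0∞))) :=
    tendsto_finsetSum _ fun σ _ => h.tendsto_exp_mul_permTerm hv σ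
  have hN : (Nat.factorial N : ℝ≥0∞) ≠ 0 := by exact_mod_cast (Nat.factorial_pos N).ne'
  have hconst := ENNReal.Tendsto.const_mul hsum (Or.inr (ENNReal.inv_ne_top.2 hN))
  have hone : (Nat.factorial N : ℝ≥0∞)⁻¹ * ∑ _σ : Equiv.Perm (Fin N), (1 : ℝ≥0∞) = 1 := by
    rw [Finset.sum_const, Finset.card_univ, Fintype.card_perm, Fintype.card_fin, nsmul_eq_mul,
      mul_one, ENNReal.inv_mul_cancel hN (ENNReal.natCast_ne_top _)]
  rw [hone] at hconst
  refine hconst.congr fun β => ?_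
  rw [loopPartition, Finset.mul_sum, Finset.mul_sum, Finset.mul_sum]
  refine Finset.sum_congr rfl fun σ _ => ?_
  ring

/-- Eventually the partition function is finite and positive. [folklore] -/
theorem eventually_loopPartition_pos_lt_top (h : IsLoopGroundState v L Ψ₀) (hv : Measurable v) :
    ∀ᶠ β : ℝ in atTop, 0 < loopPartition v N L β ∧ loopPartition v N L β < ⊤ := by
  have ht := h.tendsto_exp_mul_loopPartition hv
  have hlo : ∀ᶠ β : ℝ in atTop, (1 : ℝ≥0∞) / 2 <
      ENNReal.ofReal (Real.exp ((periodicGroundStateEnergy v N L).toReal * β)) *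
        loopPartition v N L β :=
    ht.eventually (lt_mem_nhds (by norm_num))
  have hhi : ∀ᶠ β : ℝ in atTop,
      ENNReal.ofReal (Real.exp ((periodicGroundStateEnergy v N L).toReal * β)) *
        loopPartition v N L β < 2 :=
    ht.eventually (gt_mem_nhds (by norm_num))
  filter_upwards [hlo, hhi] with β h1 h2
  constructor
  · refine pos_iff_ne_zero.2 fun h0 => ?_
    rw [h0, mul_zero] at h1
    exact absurd h1 (not_lt.2 bot_le)
  · refine lt_top_iff_ne_top.2 fun htop => ?_
    rw [htop, ENNReal.mul_top (ENNReal.ofReal_pos.2 (Real.exp_pos _)).ne'] at h2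
    exact absurd h2 (not_lt.2 le_top)

/-- **The free energy converges to the variational ground-state energy**:
`F_β(N, L) = -β⁻¹ log Z_β(N, L) → E₀ = periodicGroundStateEnergy v N L` as `β → ∞` — the
zero-temperature limit of the loop gas is governed by the infimum of the periodic quadratic form
over `PeriodicTrialState N L`. [cite: GlimmJaffeQP1987, §3.4 (3.4.2)] -/
theorem tendsto_loopFreeEnergy (h : IsLoopGroundState v L Ψ₀) (hv : Measurable v) :
    Tendsto (loopFreeEnergy v N L) atTop (𝓝 (periodicGroundStateEnergy v N L).toReal) := by
  set E : ℝ := (periodicGroundStateEnergy v N L).toReal with hE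
  -- the real renormalised partition function `r β = e^{Eβ} Z_β` tends to `1`
  set r : ℝ → ℝ := fun β => Real.exp (E * β) * (loopPartition v N L β).toReal with hr
  have hr1 : Tendsto r atTop (𝓝 1) := by
    have ht := (ENNReal.tendsto_toReal ENNReal.one_ne_top).comp (h.tendsto_exp_mul_loopPartition hv)
    rw [ENNReal.toReal_one] at ht
    refine ht.congr fun β => ?_
    simp only [Function.comp_apply, ENNReal.toReal_mul, ENNReal.toReal_ofReal (Real.exp_pos _).le, hr,
      hE]
  -- hence `log r β → 0` and `log r β / β → 0`
  have hlog : Tendsto (fun β => Real.log (r β)) atTop (𝓝 0) := by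
    have := (Real.continuousAt_log one_ne_zero).tendsto.comp hr1
    rwa [Real.log_one] at this
  have hdiv : Tendsto (fun β => Real.log (r β) / β) atTop (𝓝 0) := hlog.div_atTop tendsto_id
  -- eventually `Z_β ∈ (0, ∞)`, where `F_β = E - log (r β) / β`
  have hev : ∀ᶠ β : ℝ in atTop, loopFreeEnergy v N L β = E - Real.log (r β) / β := by
    filter_upwards [h.eventually_loopPartition_pos_lt_top hv, eventually_gt_atTop 0] with β hβ hβ0
    have hZ : 0 < (loopPartition v N L β).toReal := ENNReal.toReal_pos hβ.1.ne' hβ.2.ne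
    rw [loopFreeEnergy, hr]
    simp only
    rw [Real.log_mul (Real.exp_pos _).ne' hZ.ne', Real.log_exp]
    field_simp
    ring
  have hlim : Tendsto (fun β => E - Real.log (r β) / β) atTop (𝓝 E) := by
    simpa using (tendsto_const_nhds (x := E)).sub hdiv
  exact (hlim.congr' (hev.mono fun β hβ => hβ.symm))


/-! #### The limit of the one-particle density matrix -/

variable {n : ℕ} {Φ₀ : Config (n + 1) → ℝ}

/-- Slicing the torus kernel at a tagged pair `(x, y)`: `U ↦ K^per_β((x,U), σ·(y,U))` is measurable.
[folklore] -/
theorem _root_.Literature.MathematicalPhysics.QuantumManyBody.BoseGas.measurable_torusKernel_vecCons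
    {v : ℝ → ℝ≥0∞} (hv : Measurable v) (L β : ℝ) (x y : Space) (σ : Equiv.Perm (Fin (n + 1))) :
    Measurable fun U : Config n =>
      torusKernel v L β (Matrix.vecCons x U) (Matrix.vecCons y U ∘ σ) := by
  have h1 : Measurable fun U : Config n => (Matrix.vecCons x U : Config (n + 1)) :=
    (continuous_const.matrixVecCons continuous_id).measurable
  have h2 : Measurable fun U : Config n => (Matrix.vecCons y U : Config (n + 1)) :=
    (continuous_const.matrixVecCons continuous_id).measurable
  have hg : Measurable fun U : Config n =>
      ((Matrix.vecCons x U : Config (n + 1)), (Matrix.vecCons y U ∘ σ : Config (n + 1))) :=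
    h1.prodMk ((measurable_comp_perm σ).comp h2)
  simpa only [Function.comp_def] using (measurable_torusKernel_uncurry hv L β).comp hg

/-- **The renormalised open-line weight converges**:
`e^{βE₀} w_β(x, y) → ∫_{cell^{N-1}} Ψ₀(x, U) Ψ₀(y, U) dU` (dominated convergence in each of the
`N!` permutation sectors, Bose symmetry of `Ψ₀` absorbing `σ`). [cite: GlimmJaffeQP1987, §3.4 (3.4.2)] -/
theorem tendsto_exp_mul_openLineKernel (h : IsLoopGroundState v L Φ₀) (hv : Measurable v)
    (x y : Space) :
    Tendsto (fun β : ℝ =>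
      ENNReal.ofReal (Real.exp ((periodicGroundStateEnergy v (n + 1) L).toReal * β)) *
        openLineKernel v (n + 1) L β x y) atTop
      (𝓝 (∫⁻ U in cellN n L, ENNReal.ofReal (Φ₀ (Matrix.vecCons x U)) *
        ENNReal.ofReal (Φ₀ (Matrix.vecCons y U)))) := by
  obtain ⟨C, hC⟩ := h.kernel_bound
  set G : ℝ≥0∞ := ∫⁻ U in cellN n L, ENNReal.ofReal (Φ₀ (Matrix.vecCons x U)) *
    ENNReal.ofReal (Φ₀ (Matrix.vecCons y U)) with hG
  have hσ : ∀ σ : Equiv.Perm (Fin (n + 1)), Tendsto (fun β : ℝ => ∫⁻ U in cellN n L,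
      ENNReal.ofReal (Real.exp ((periodicGroundStateEnergy v (n + 1) L).toReal * β)) *
        torusKernel v L β (Matrix.vecCons x U) (Matrix.vecCons y U ∘ σ)) atTop (𝓝 G) := by
    intro σ
    refine tendsto_lintegral_filter_of_dominated_convergence (fun _ => (C : ℝ≥0∞)) ?_ ?_ ?_ ?_
    · exact Eventually.of_forall fun β =>
        (measurable_torusKernel_vecCons hv L β x y σ).const_mul _
    · filter_upwards [hC] with β hβ using Eventually.of_forall fun U => hβ _ _
    · rw [setLIntegral_const, volume_cellN]
      exact ENNReal.mul_ne_top ENNReal.coe_ne_top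
        (ENNReal.pow_ne_top (ENNReal.pow_ne_top ENNReal.ofReal_ne_top))
    · refine Eventually.of_forall fun U => ?_
      have := h.kernel_tendsto (Matrix.vecCons x U) (Matrix.vecCons y U ∘ σ)
      rwa [h.symm σ] at this
  have hsum := tendsto_finsetSum (Finset.univ : Finset (Equiv.Perm (Fin (n + 1)))) fun σ _ => hσ σ
  have hN : (Nat.factorial (n + 1) : ℝ≥0∞) ≠ 0 := by exact_mod_cast (Nat.factorial_pos _).ne'
  have hconst := ENNReal.Tendsto.const_mul hsum (Or.inr (ENNReal.inv_ne_top.2 hN))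
  have hone : (Nat.factorial (n + 1) : ℝ≥0∞)⁻¹ * ∑ _σ : Equiv.Perm (Fin (n + 1)), G = G := by
    rw [Finset.sum_const, Finset.card_univ, Fintype.card_perm, Fintype.card_fin, nsmul_eq_mul,
      ← mul_assoc, ENNReal.inv_mul_cancel hN (ENNReal.natCast_ne_top _), one_mul]
  rw [hone] at hconst
  refine hconst.congr fun β => ?_
  rw [openLineKernel_succ, Finset.mul_sum, Finset.mul_sum, Finset.mul_sum]
  refine Finset.sum_congr rfl fun σ _ => ?_
  rw [lintegral_const_mul _ (measurable_torusKernel_vecCons hv L β x y σ)]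
  ring

/-- **The one-particle density matrix of the Gibbs state converges to that of the ground state**:
`γ_β(x, y) → N ∫_{cell^{N-1}} Ψ₀(x, U) Ψ₀(y, U) dU` as `β → ∞`, for every `x, y` — the right-hand
side being, for `x, y` in the cell, the kernel `densityMatrix N (𝟙_{cell^N} Ψ₀) x y` of
`OneParticleMarginals.lean` whose constant-mode expectation is `condensateOccupation N L Ψ₀`.
[cite: GlimmJaffeQP1987, §3.4 (3.4.2)] -/
theorem tendsto_loopDensityMatrix (h : IsLoopGroundState v L Φ₀) (hv : Measurable v) (x y : Space) :
    Tendsto (fun β : ℝ => loopDensityMatrix v (n + 1) L β x y) atTop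
      (𝓝 ((n + 1 : ℕ) * ∫⁻ U in cellN n L, ENNReal.ofReal (Φ₀ (Matrix.vecCons x U)) *
        ENNReal.ofReal (Φ₀ (Matrix.vecCons y U)))) := by
  have hA := ENNReal.Tendsto.const_mul (h.tendsto_exp_mul_openLineKernel hv x y)
    (Or.inr (ENNReal.natCast_ne_top (n + 1)))
  have hB := h.tendsto_exp_mul_loopPartition hv
  have hdiv := ENNReal.Tendsto.div hA (Or.inr one_ne_zero) hB (Or.inl ENNReal.one_ne_top)
  rw [div_one] at hdiv
  refine hdiv.congr fun β => ?_
  have he : ENNReal.ofReal (Real.exp ((periodicGroundStateEnergy v (n + 1) L).toReal * β)) ≠ 0 :=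
    (ENNReal.ofReal_pos.2 (Real.exp_pos _)).ne'
  rw [loopDensityMatrix, mul_left_comm, ENNReal.mul_div_mul_left _ _ he ENNReal.ofReal_ne_top]


/-- The open-line weight is jointly measurable in the tagged pair `(x, y)` (for measurable `v`).
[folklore] -/
theorem _root_.Literature.MathematicalPhysics.QuantumManyBody.BoseGas.measurable_openLineKernel_uncurry
    {v : ℝ → ℝ≥0∞} (hv : Measurable v) (n : ℕ) (L β : ℝ) :
    Measurable fun q : Space × Space => openLineKernel v (n + 1) L β q.1 q.2 := by
  simp only [openLineKernel_succ]
  refine Measurable.const_mul (Finset.measurable_sum _ fun σ _ => ?_) _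
  have h1 : Measurable fun r : (Space × Space) × Config n =>
      (Matrix.vecCons r.1.1 r.2 : Config (n + 1)) :=
    ((continuous_fst.comp continuous_fst).matrixVecCons continuous_snd).measurable
  have h2 : Measurable fun r : (Space × Space) × Config n =>
      (Matrix.vecCons r.1.2 r.2 : Config (n + 1)) :=
    ((continuous_snd.comp continuous_fst).matrixVecCons continuous_snd).measurable
  have hg : Measurable fun r : (Space × Space) × Config n =>
      ((Matrix.vecCons r.1.1 r.2 : Config (n + 1)), (Matrix.vecCons r.1.2 r.2 ∘ σ : Config (n + 1))) :=
    h1.prodMk ((measurable_comp_perm σ).comp h2)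
  have h : Measurable fun r : (Space × Space) × Config n =>
      torusKernel v L β (Matrix.vecCons r.1.1 r.2) (Matrix.vecCons r.1.2 r.2 ∘ σ) := by
    simpa only [Function.comp_def] using (measurable_torusKernel_uncurry hv L β).comp hg
  exact h.lintegral_prod_right'

/-- The one-particle density matrix is jointly measurable in `(x, y)` (for measurable `v`).
[folklore] -/
theorem _root_.Literature.MathematicalPhysics.QuantumManyBody.BoseGas.measurable_loopDensityMatrix_uncurry
    {v : ℝ → ℝ≥0∞} (hv : Measurable v) (n : ℕ) (L β : ℝ) :
    Measurable fun q : Space × Space => loopDensityMatrix v (n + 1) L β q.1 q.2 := by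
  simp only [loopDensityMatrix, div_eq_mul_inv]
  exact ((measurable_openLineKernel_uncurry hv n L β).const_mul _).mul_const _

/-- Eventually (in `β`) the renormalised open-line weight is uniformly bounded. [folklore] -/
theorem eventually_exp_mul_openLineKernel_le (h : IsLoopGroundState v L Φ₀) :
    ∃ W : ℝ≥0∞, W ≠ ⊤ ∧ ∀ᶠ β : ℝ in atTop, ∀ x y : Space,
      ENNReal.ofReal (Real.exp ((periodicGroundStateEnergy v (n + 1) L).toReal * β)) *
        openLineKernel v (n + 1) L β x y ≤ W := by
  obtain ⟨C, hC⟩ := h.kernel_bound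
  refine ⟨C * volume (cellN n L), ENNReal.mul_ne_top ENNReal.coe_ne_top ?_, ?_⟩
  · rw [volume_cellN]
    exact ENNReal.pow_ne_top (ENNReal.pow_ne_top ENNReal.ofReal_ne_top)
  filter_upwards [hC] with β hβ x y
  have hN : (Nat.factorial (n + 1) : ℝ≥0∞) ≠ 0 := by exact_mod_cast (Nat.factorial_pos _).ne'
  calc ENNReal.ofReal (Real.exp ((periodicGroundStateEnergy v (n + 1) L).toReal * β)) *
        openLineKernel v (n + 1) L β x y
      = (Nat.factorial (n + 1) : ℝ≥0∞)⁻¹ * ∑ σ : Equiv.Perm (Fin (n + 1)), ∫⁻ U in cellN n L,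
          ENNReal.ofReal (Real.exp ((periodicGroundStateEnergy v (n + 1) L).toReal * β)) *
            torusKernel v L β (Matrix.vecCons x U) (Matrix.vecCons y U ∘ σ) := by
        rw [openLineKernel_succ, ← mul_assoc, mul_comm (ENNReal.ofReal _), mul_assoc, Finset.mul_sum]
        congr 1
        refine Finset.sum_congr rfl fun σ _ => ?_
        rw [← lintegral_const_mul' _ _ ENNReal.ofReal_ne_top]
    _ ≤ (Nat.factorial (n + 1) : ℝ≥0∞)⁻¹ * ∑ _σ : Equiv.Perm (Fin (n + 1)), ∫⁻ _U in cellN n L, (C : ℝ≥0∞) := by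
        gcongr with σ _ U
        exact hβ _ _
    _ = C * volume (cellN n L) := by
        rw [setLIntegral_const, Finset.sum_const, Finset.card_univ, Fintype.card_perm, Fintype.card_fin,
          nsmul_eq_mul, ← mul_assoc, ENNReal.inv_mul_cancel hN (ENNReal.natCast_ne_top _), one_mul]

/-- Eventually (in `β`) the one-particle density matrix is uniformly bounded. [folklore] -/
theorem eventually_loopDensityMatrix_le (h : IsLoopGroundState v L Φ₀) (hv : Measurable v) :
    ∃ B : ℝ≥0∞, B ≠ ⊤ ∧ ∀ᶠ β : ℝ in atTop, ∀ x y : Space,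
      loopDensityMatrix v (n + 1) L β x y ≤ B := by
  obtain ⟨W, hW, hev⟩ := h.eventually_exp_mul_openLineKernel_le
  refine ⟨(n + 1 : ℕ) * W / (1 / 2), ?_, ?_⟩
  · exact (ENNReal.div_lt_top (ENNReal.mul_ne_top (ENNReal.natCast_ne_top _) hW) (by norm_num)).ne
  have hlo : ∀ᶠ β : ℝ in atTop, (1 : ℝ≥0∞) / 2 <
      ENNReal.ofReal (Real.exp ((periodicGroundStateEnergy v (n + 1) L).toReal * β)) *
        loopPartition v (n + 1) L β :=
    (h.tendsto_exp_mul_loopPartition hv).eventually (lt_mem_nhds (by norm_num))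
  filter_upwards [hev, hlo] with β hβ hZ x y
  have he : ENNReal.ofReal (Real.exp ((periodicGroundStateEnergy v (n + 1) L).toReal * β)) ≠ 0 :=
    (ENNReal.ofReal_pos.2 (Real.exp_pos _)).ne'
  rw [loopDensityMatrix, ← ENNReal.mul_div_mul_left _ _ he ENNReal.ofReal_ne_top, ← mul_left_comm]
  exact (ENNReal.div_le_div_left hZ.le _).trans (ENNReal.div_le_div_right (mul_le_mul' le_rfl (hβ x y)) _)

/-- **The condensate occupation of the Gibbs state converges to that of the ground state**:
`⟨φ₀, γ_β φ₀⟩ = L⁻³ ∫∫_{cell²} γ_β → L⁻³ ∫∫_{cell²} N ∫_{cell^{N-1}} Ψ₀(x,U) Ψ₀(y,U) dU dx dy` as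
`β → ∞` (`L > 0`; dominated convergence twice) — the right-hand side is the constant-mode
occupation `N ∫_{cell^{N-1}} |∫_cell L^{-3/2} Ψ₀(x, U) dx|² dU` of `Ψ₀`, i.e. the quantity
`condensateOccupation N L Ψ₀` of `PeriodicBoseGas.lean` written with the square expanded.
[cite: GlimmJaffeQP1987, §3.4 (3.4.2)] -/
theorem tendsto_loopCondensateOccupation (h : IsLoopGroundState v L Φ₀) (hv : Measurable v)
    (hL : 0 < L) :
    Tendsto (fun β : ℝ => loopCondensateOccupation v (n + 1) L β) atTop
      (𝓝 ((ENNReal.ofReal L ^ 3)⁻¹ * ∫⁻ x in cell L, ∫⁻ y in cell L,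
        (n + 1 : ℕ) * ∫⁻ U in cellN n L, ENNReal.ofReal (Φ₀ (Matrix.vecCons x U)) *
          ENNReal.ofReal (Φ₀ (Matrix.vecCons y U)))) := by
  obtain ⟨B, hB, hev⟩ := h.eventually_loopDensityMatrix_le hv
  have hcell : volume (cell L) ≠ ⊤ := by rw [volume_cell]; exact ENNReal.pow_ne_top ENNReal.ofReal_ne_top
  -- inner integrals
  have hinner : ∀ x : Space, Tendsto (fun β : ℝ => ∫⁻ y in cell L, loopDensityMatrix v (n + 1) L β x y)
      atTop (𝓝 (∫⁻ y in cell L, (n + 1 : ℕ) * ∫⁻ U in cellN n L,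
        ENNReal.ofReal (Φ₀ (Matrix.vecCons x U)) * ENNReal.ofReal (Φ₀ (Matrix.vecCons y U)))) := by
    intro x
    refine tendsto_lintegral_filter_of_dominated_convergence (fun _ => B) ?_ ?_ ?_ ?_
    · refine Eventually.of_forall fun β => ?_
      have hg : Measurable fun y : Space => (x, y) := measurable_const.prodMk measurable_id
      simpa only [Function.comp_def] using (measurable_loopDensityMatrix_uncurry hv n L β).comp hg
    · filter_upwards [hev] with β hβ using Eventually.of_forall fun y => hβ x y
    · rw [setLIntegral_const]; exact ENNReal.mul_ne_top hB hcell
    · exact Eventually.of_forall fun y => h.tendsto_loopDensityMatrix hv x y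
  -- outer integral
  have houter : Tendsto (fun β : ℝ => ∫⁻ x in cell L, ∫⁻ y in cell L, loopDensityMatrix v (n + 1) L β x y)
      atTop (𝓝 (∫⁻ x in cell L, ∫⁻ y in cell L, (n + 1 : ℕ) * ∫⁻ U in cellN n L,
        ENNReal.ofReal (Φ₀ (Matrix.vecCons x U)) * ENNReal.ofReal (Φ₀ (Matrix.vecCons y U)))) := by
    refine tendsto_lintegral_filter_of_dominated_convergence (fun _ => B * volume (cell L)) ?_ ?_ ?_ ?_
    · exact Eventually.of_forall fun β =>
        (measurable_loopDensityMatrix_uncurry hv n L β).lintegral_prod_right'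
    · filter_upwards [hev] with β hβ
      refine Eventually.of_forall fun x => ?_
      calc ∫⁻ y in cell L, loopDensityMatrix v (n + 1) L β x y ≤ ∫⁻ _y in cell L, B :=
            lintegral_mono fun y => hβ x y
        _ = B * volume (cell L) := setLIntegral_const _ _
    · rw [setLIntegral_const]
      exact ENNReal.mul_ne_top (ENNReal.mul_ne_top hB hcell) hcell
    · exact Eventually.of_forall fun x => hinner x
  have hL3 : (ENNReal.ofReal L ^ 3)⁻¹ ≠ ⊤ :=
    ENNReal.inv_ne_top.2 (pow_ne_zero 3 (ENNReal.ofReal_pos.2 hL).ne')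
  exact ENNReal.Tendsto.const_mul houter (Or.inr hL3)

end IsLoopGroundState

/-! ### The constant-mode occupation of a real state on the cell, with the square expanded -/

section Condensate

variable {n : ℕ}

/-- `(x, U) ∈ cell^{n+1}` iff `x ∈ cell` and `U ∈ cellⁿ`. [folklore] -/
theorem vecCons_mem_cellN_iff_loop {L : ℝ} {x : Space} {U : Config n} :
    Matrix.vecCons x U ∈ cellN (n + 1) L ↔ x ∈ cell L ∧ U ∈ cellN n L := by
  simp only [cellN, Set.mem_setOf_eq, Fin.forall_fin_succ, Matrix.cons_val_zero,
    Matrix.cons_val_succ]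

/-- The constant mode tested against a real cell-truncated state: for `U ∈ cellⁿ`,
`∫ conj(φ₀(x)) (𝟙_{cell^{n+1}} Ψ₀)(x, U) dx = L^{-3/2} ∫_cell Ψ₀(x, U) dx`, and `0` otherwise.
[cite: Fournais2020, (1.3)–(1.5)] -/
theorem integral_conj_constantMode_mul_indicator {L : ℝ} {Φ₀ : Config (n + 1) → ℝ} (U : Config n) :
    ∫ x, conj (constantMode L x) *
        (cellN (n + 1) L).indicator (fun X => (Φ₀ X : ℂ)) (Matrix.vecCons x U) =
      (((cellN n L).indicator
        (fun U => (Real.sqrt (L ^ 3))⁻¹ * ∫ x in cell L, Φ₀ (Matrix.vecCons x U)) U : ℝ) : ℂ) := by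
  by_cases hU : U ∈ cellN n L
  · have hpt : ∀ x, conj (constantMode L x) *
        (cellN (n + 1) L).indicator (fun X => (Φ₀ X : ℂ)) (Matrix.vecCons x U) =
        (cell L).indicator (fun x => (((Real.sqrt (L ^ 3))⁻¹ * Φ₀ (Matrix.vecCons x U) : ℝ) : ℂ)) x := by
      intro x
      by_cases hx : x ∈ cell L
      · have hX : Matrix.vecCons x U ∈ cellN (n + 1) L := vecCons_mem_cellN_iff_loop.2 ⟨hx, hU⟩
        simp [constantMode, Set.indicator_of_mem hx, Set.indicator_of_mem hX, Complex.ofReal_mul]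
      · have hX : Matrix.vecCons x U ∉ cellN (n + 1) L := fun h =>
          hx (vecCons_mem_cellN_iff_loop.1 h).1
        simp [constantMode, Set.indicator_of_notMem hx, Set.indicator_of_notMem hX]
    simp_rw [hpt]
    rw [integral_indicator (measurableSet_cell L), Set.indicator_of_mem hU, integral_complex_ofReal,
      integral_const_mul]
  · have hpt : ∀ x, conj (constantMode L x) *
        (cellN (n + 1) L).indicator (fun X => (Φ₀ X : ℂ)) (Matrix.vecCons x U) = 0 := by
      intro x
      have hX : Matrix.vecCons x U ∉ cellN (n + 1) L := fun h =>
        hU (vecCons_mem_cellN_iff_loop.1 h).2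
      simp [Set.indicator_of_notMem hX]
    simp [hpt, Set.indicator_of_notMem hU]

/-- The `N`-particle cell is measurable. [folklore] -/
theorem measurableSet_cellN_loop (N : ℕ) (L : ℝ) : MeasurableSet (cellN N L) := by
  have : cellN N L = ⋂ i : Fin N, (fun X : Config N => X i) ⁻¹' cell L := by
    ext X; simp [cellN]
  rw [this]
  exact MeasurableSet.iInter fun i => (measurableSet_cell L).preimage (measurable_pi_apply i)

/-- **The constant-mode occupation of a real, nonnegative, bounded state, with the square
expanded**: `condensateOccupation N L Ψ₀ = N ∫_{cell^{N-1}} |∫_cell L^{-3/2} Ψ₀(x, U) dx|² dU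
= L⁻³ ∫_cell ∫_cell N ∫_{cell^{N-1}} Ψ₀(x, U) Ψ₀(y, U) dU dy dx` — the form in which the `β → ∞`
limit of the Gibbs condensate occupation arrives (`IsLoopGroundState.tendsto_loopCondensateOccupation`).
[cite: Fournais2020, (1.3)–(1.5)] -/
theorem condensateOccupation_ofReal_eq {L : ℝ} (hL : 0 < L) {Φ₀ : Config (n + 1) → ℝ}
    (hm : Measurable Φ₀) (h0 : ∀ X, 0 ≤ Φ₀ X) {M : ℝ} (hM : ∀ X, Φ₀ X ≤ M) :
    condensateOccupation (n + 1) L (fun X => (Φ₀ X : ℂ)) =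
      (ENNReal.ofReal L ^ 3)⁻¹ * ∫⁻ x in cell L, ∫⁻ y in cell L,
        (n + 1 : ℕ) * ∫⁻ U in cellN n L,
          ENNReal.ofReal (Φ₀ (Matrix.vecCons x U)) * ENNReal.ofReal (Φ₀ (Matrix.vecCons y U)) := by
  -- joint measurability of `(x, U) ↦ Ψ₀(x, U)` and its sections
  have hvc : Measurable fun p : Space × Config n => (Matrix.vecCons p.1 p.2 : Config (n + 1)) :=
    (continuous_fst.matrixVecCons continuous_snd).measurable
  have hfm : Measurable fun p : Space × Config n => ENNReal.ofReal (Φ₀ (Matrix.vecCons p.1 p.2)) :=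
    ENNReal.measurable_ofReal.comp (hm.comp hvc)
  have hfx : ∀ x : Space, Measurable fun U : Config n => ENNReal.ofReal (Φ₀ (Matrix.vecCons x U)) :=
    fun x => hfm.comp (measurable_const.prodMk measurable_id)
  have hfU : ∀ U : Config n, Measurable fun x : Space => ENNReal.ofReal (Φ₀ (Matrix.vecCons x U)) :=
    fun U => hfm.comp (measurable_id.prodMk measurable_const)
  have hrU : ∀ U : Config n, Measurable fun x : Space => Φ₀ (Matrix.vecCons x U) :=
    fun U => hm.comp (hvc.comp (measurable_id.prodMk measurable_const))
  -- integrability of the cell slices (bounded on a set of finite measure)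
  have hcell : volume (cell L) ≠ ⊤ := by
    rw [volume_cell]; exact ENNReal.pow_ne_top ENNReal.ofReal_ne_top
  have hI : ∀ U : Config n, Integrable (fun x => Φ₀ (Matrix.vecCons x U)) (volume.restrict (cell L)) :=
    fun U => Measure.integrableOn_of_bounded hcell (hrU U).aestronglyMeasurable
      (ae_of_all _ fun x => by
        rw [Real.norm_of_nonneg (h0 _)]
        exact hM _)
  have hL3 : (ENNReal.ofReal L ^ 3)⁻¹ ≠ ⊤ :=
    ENNReal.inv_ne_top.2 (pow_ne_zero 3 (ENNReal.ofReal_pos.2 hL).ne')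
  -- Step A: unfold the occupation
  have hA : condensateOccupation (n + 1) L (fun X => (Φ₀ X : ℂ)) =
      (n + 1 : ℝ≥0∞) * ∫⁻ U, (‖∫ x, conj (constantMode L x) *
        (cellN (n + 1) L).indicator (fun X => (Φ₀ X : ℂ)) (Matrix.vecCons x U)‖₊ : ℝ≥0∞) ^ 2 :=
    rfl
  -- Step B: the integrand
  have hB : ∀ U : Config n, (‖∫ x, conj (constantMode L x) *
        (cellN (n + 1) L).indicator (fun X => (Φ₀ X : ℂ)) (Matrix.vecCons x U)‖₊ : ℝ≥0∞) ^ 2 =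
      (cellN n L).indicator (fun U => (ENNReal.ofReal L ^ 3)⁻¹ *
        ∫⁻ x in cell L, ∫⁻ y in cell L,
          ENNReal.ofReal (Φ₀ (Matrix.vecCons x U)) * ENNReal.ofReal (Φ₀ (Matrix.vecCons y U))) U := by
    intro U
    rw [integral_conj_constantMode_mul_indicator]
    by_cases hU : U ∈ cellN n L
    · rw [Set.indicator_of_mem hU, Set.indicator_of_mem hU,
        lintegral_lintegral_mul (hfU U).aemeasurable (hfU U).aemeasurable, ← sq,
        ← ofReal_integral_eq_lintegral_ofReal (hI U) (ae_of_all _ fun x => h0 _)]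
      have hIU : 0 ≤ ∫ x in cell L, Φ₀ (Matrix.vecCons x U) :=
        setIntegral_nonneg (measurableSet_cell L) fun x _ => h0 _
      have hs : 0 ≤ (Real.sqrt (L ^ 3))⁻¹ := inv_nonneg.2 (Real.sqrt_nonneg _)
      have hr : 0 ≤ (Real.sqrt (L ^ 3))⁻¹ * ∫ x in cell L, Φ₀ (Matrix.vecCons x U) :=
        mul_nonneg hs hIU
      rw [Complex.nnnorm_real, ← enorm_eq_nnnorm, Real.enorm_eq_ofReal hr,
        ← ENNReal.ofReal_pow hr, mul_pow, ENNReal.ofReal_mul (sq_nonneg _),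
        ENNReal.ofReal_pow hIU]
      congr 1
      rw [inv_pow, Real.sq_sqrt (by positivity), ENNReal.ofReal_inv_of_pos (by positivity),
        ENNReal.ofReal_pow hL.le]
    · simp [Set.indicator_of_notMem hU]
  -- Step C: assemble and exchange the integrals
  rw [hA]
  simp_rw [hB]
  rw [lintegral_indicator (measurableSet_cellN_loop n L), lintegral_const_mul' _ _ hL3, ← mul_assoc,
    mul_comm (n + 1 : ℝ≥0∞), mul_assoc]
  congr 1
  -- the triple integrand is jointly measurable
  have hg : Measurable fun q : (Config n × Space) × Space =>
      ENNReal.ofReal (Φ₀ (Matrix.vecCons q.1.2 q.1.1)) * ENNReal.ofReal (Φ₀ (Matrix.vecCons q.2 q.1.1)) :=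
    (hfm.comp ((measurable_snd.comp measurable_fst).prodMk (measurable_fst.comp measurable_fst))).mul
      (hfm.comp (measurable_snd.prodMk (measurable_fst.comp measurable_fst)))
  have hgy : Measurable fun q : Config n × Space => ∫⁻ y in cell L,
      ENNReal.ofReal (Φ₀ (Matrix.vecCons q.2 q.1)) * ENNReal.ofReal (Φ₀ (Matrix.vecCons y q.1)) :=
    hg.lintegral_prod_right'
  rw [lintegral_lintegral_swap hgy.aemeasurable, ← lintegral_const_mul _ ?_]
  swap
  · exact (hgy.comp measurable_swap).lintegral_prod_right'
  refine lintegral_congr fun x => ?_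
  have hgx : Measurable fun q : Config n × Space =>
      ENNReal.ofReal (Φ₀ (Matrix.vecCons x q.1)) * ENNReal.ofReal (Φ₀ (Matrix.vecCons q.2 q.1)) :=
    ((hfx x).comp measurable_fst).mul (hfm.comp (measurable_snd.prodMk measurable_fst))
  rw [lintegral_lintegral_swap hgx.aemeasurable, ← lintegral_const_mul _ ?_]
  swap
  · exact (hgx.comp measurable_swap).lintegral_prod_right'
  refine lintegral_congr fun y => ?_
  rw [Nat.cast_add_one]

end Condensate

namespace IsLoopGroundState

variable {v : ℝ → ℝ≥0∞} {L : ℝ} {n : ℕ} {Φ₀ : Config (n + 1) → ℝ}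

/-- A loop ground state is bounded (`Ψ₀² ≤ C` from the kernel bound). [folklore] -/
theorem bounded {N : ℕ} {Ψ₀ : Config N → ℝ} (h : IsLoopGroundState v L Ψ₀) :
    ∃ M : ℝ, ∀ X, Ψ₀ X ≤ M := by
  obtain ⟨C, hC⟩ := h.ofReal_mul_ofReal_le
  refine ⟨Real.sqrt C, fun X => ?_⟩
  have h2 : Ψ₀ X * Ψ₀ X ≤ C := by
    have := hC X X
    rw [← ENNReal.ofReal_mul (h.nonneg X), ENNReal.ofReal_le_iff_le_toReal ENNReal.coe_ne_top] at this
    simpa using this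
  exact (Real.le_sqrt (h.nonneg X) C.2).2 (by rw [sq]; exact h2)

/-- **The Gibbs condensate occupation converges to the ground-state condensate occupation of the
tree**: `⟨φ₀, γ_β φ₀⟩ → condensateOccupation N L Ψ₀` as `β → ∞` (`L > 0`), the quantity in which
route items state Bose–Einstein condensation of periodic near-minimisers.
[cite: GlimmJaffeQP1987, §3.4 (3.4.2)] -/
theorem tendsto_loopCondensateOccupation_condensateOccupation (h : IsLoopGroundState v L Φ₀)
    (hv : Measurable v) (hL : 0 < L) :
    Tendsto (fun β : ℝ => loopCondensateOccupation v (n + 1) L β) atTop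
      (𝓝 (condensateOccupation (n + 1) L fun X => (Φ₀ X : ℂ))) := by
  obtain ⟨M, hM⟩ := h.bounded
  rw [condensateOccupation_ofReal_eq hL h.measurable h.nonneg hM]
  exact h.tendsto_loopCondensateOccupation hv hL

end IsLoopGroundState


end Literature.MathematicalPhysics.QuantumManyBody.BoseGas

end
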